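import Literature.RepresentationTheory.FiniteGroups.KLRGradedCellularBasisProofs
import HarnessLib

/-!
# Towards `KLRGradedCellularBasis_holds`, II: the braid relation (EI6) for Brundan–Kleshchev's `φ_r`

Topic `Literature/RepresentationTheory/FiniteGroups`; second "Proofs" sibling of
`KLRGradedCellularBasis.lean` (the named fact `KLRGradedCellularBasis`, Hu–Mathas 2010, Main
Theorem, level one and degenerate), continuing `KLRGradedCellularBasisProofs.lean` (which reached
its size limit) with the same conventions (D-0026: inline lemmas, no new named facts). That file
constructs, inside `k[S_n]`, the Jucys–Murphy elements `L_r`, the KLR idempotents `e(𝐢)`, the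
nilpotents `y_r`, the intertwiners `θ_r` (`bkIntertwiner`) and `φ_r` (`bkPhi`), and proves
Brundan–Kleshchev's Lemma 3.1 (arXiv:0808.2032) except for three cases of its braid relation
(EI6). Here:

* `jucysMurphy_sub_mul_of_mem` — `(L_a - L_b) w = ((i_a - i_b) + y_a - y_b) w` for `w ∈ M_𝐢`;
  `bkIntertwiner_mul_bkIntertwiner_succ`, `bkIntertwiner_succ_mul_bkIntertwiner` — the expansions
  of `θ_rθ_{r+1}`, `θ_{r+1}θ_r` with the `x`'s on the right;
* `bk_braid_case2_aux` — the ring-theoretic core of Cases 2 and 3 of Brundan–Kleshchev's proof of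
  (EI6): `P (a + 1) e = (b + 1) P e` for `P = (ab WV + aW + bV + 1) ι₁₃ ι₂₃`
  (`= θ_rθ_{r+1} x_{r,r+2}^{-1} x_{r+1,r+2}^{-1}`), from the degenerate affine Hecke relations, the
  actions `W w = D₁₃ w`, `V w = D₂₃ w` on `w ∈ {e, ae}` and the commutations available in `k[S_n]`
  (both sides equal BK's `s_2s_1s_2 + s_2s_1x_{23}^{-1} + s_2x_{23}^{-1}x_{13}^{-1} + x_{13}^{-1} + Pe`);
* `bkPhi_braid_of_eq_ne`, `bkPhi_braid_of_ne_eq` — **(EI6) of BK Lemma 3.1,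
  `φ_rφ_{r+1}φ_r e(𝐢) = φ_{r+1}φ_rφ_{r+1} e(𝐢)`, in the cases `i_r = i_{r+1} ≠ i_{r+2}` and
  `i_r ≠ i_{r+1} = i_{r+2}`** (Brundan–Kleshchev 2009, Lemma 3.1 (3.12); Cases 2 and 3 of the
  proof, the second being the first with `s_r ↔ s_{r+1}`, `x_{r+1,r+2} ↔ x_{r,r+1}`).

* `bk_braid_case4_aux`, `bk_braid_case4_combine`, `of_swap_mul_mem_of_eq`,
  `bkPhi_expansion_case4`, `bkPhi_expansion_case4'`, `bkPhi_braid_of_eq_of_ne` — **(EI6) in the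
  last case `i_r = i_{r+2} ≠ i_{r+1}`: `φ_rφ_{r+1}φ_r e(𝐢) = (φ_{r+1}φ_rφ_{r+1} + z_r) e(𝐢)`,
  `z_r = (x_{r,r+1}^{-1} - x_{r+1,r+2}^{-1})(x_{r,r+1}^{-1}x_{r+1,r+2}^{-1} - x_{r,r+1}^{-1} -
  x_{r+1,r+2}^{-1})`** (Case 4 of the proof: Brundan–Kleshchev's expansion
  `φ_{r+1}φ_rφ_{r+1} e = (s_2s_1s_2 + s_2s_1x_{23}^{-1} + s_1s_2x_{12}^{-1} + s_2x_{12}^{-1}x_{23}^{-1}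
  + s_1x_{12}^{-1}x_{23}^{-1} + x_{12}^{-1} + (x_{23}^{-2}-1)(x_{12}^{-1}-1)) e`, as a ring lemma
  instantiated in both directions, and the difference of the two expansions).

With this, Brundan–Kleshchev's Lemma 3.1 ((EI0)–(EI6)) is completely proved for `k[S_n]`.

* `bkP`, `bkQ`, `bkPsi`, `isUnit_bkQ`, `commute_bkQ`, `bkPsi_mul_klrIdempotent`,
  `bkPhi_mul_klrIdempotent_eq_swap_add_bkP`, `bkPhi_mul_sum_smul_klrIdempotent`,
  `bkPhi_mul_bkNilpotent_of_ne` — **Brundan–Kleshchev's Khovanov–Lauda generators (BK §3.3):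
  `p_r(𝐢)` ((3.22)), the explicit `q_r(𝐢)` of (3.30) for the quiver `i → j ⟺ j = i + 1` (all
  units of `k[S_n]`: the power series involved are rational in the `y`'s with unit denominators),
  `ψ_r = ∑_𝐢 φ_r q_r(𝐢)^{-1} e(𝐢)` ((3.32)), `φ_r e(𝐢) = (s_r + p_r(𝐢)) e(𝐢)` ((3.27))**, and the
  first relations of BK Theorem 3.2: `bkPsi_mul_klrIdempotent_eq` (**`ψ_r e(𝐢) = e(s_r𝐢) ψ_r`**),
  `bkPsi_mul_bkNilpotent_of_ne` (**`ψ_r y_t = y_t ψ_r`, `t ∉ {r, r+1}`**),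
  `bkNilpotent_succ_mul_bkPsi_mul_klrIdempotent` (**`y_{r+1}ψ_r e(𝐢) = (ψ_ry_r + δ_{i_ri_{r+1}})e(𝐢)`**,
  (R5), from (EI4)), `bkPsi_mul_bkNilpotent_succ_mul_klrIdempotent` (**`ψ_ry_{r+1}e(𝐢) = (y_rψ_r +
  δ_{i_ri_{r+1}})e(𝐢)`**, (R6), from (EI3)), `bkPsi_comm_of_far` (**`ψ_rψ_t = ψ_tψ_r`, `|r - t| > 1`**,
  from (EI2)).

* `mul_left_mem_jointEigenspace_of_comm`, `bkPhi_mul_mem`, `bkPhi_mul_bkNilpotent_succ_mul_of_mem`,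
  `bkPhi_mul_bkNilpotent_mul_of_mem`, `bkPhi_mul_bkDiffUnit_mul_of_mem`,
  `bkPhi_mul_ringInverse_bkDiffUnit_mul_of_mem` — **`φ_r` exchanges `y_r` and `y_{r+1}` on `M_𝐢`
  for `i_r ≠ i_{r+1}`** (`φ_r f(y_r, y_{r+1}) w = f(y_{r+1}, y_r) φ_r w`, the mechanism behind
  Brundan–Kleshchev's twisted power series `{}^{s_r}f`); `bkPsi_mul_bkPsi_mul_klrIdempotent`
  (**`ψ_r² e(𝐢) = φ_r q_r(s_r𝐢)^{-1} φ_r q_r(𝐢)^{-1} e(𝐢)`**, BK (3.35)) and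
  `bkPsi_mul_bkPsi_mul_klrIdempotent_of_eq` (**(R4) for `i_r = i_{r+1}`: `ψ_r² e(𝐢) = 0`**, via
  `(s_r+1)(1+x_{r,r+1}) = (1-x_{r,r+1})(s_r-1)` and `s_r² = 1`).

* `bkQs` (**`{}^{s_r}q_r(s_r𝐢)`** as an element), `bkPhi_mul_bkP_mul_of_mem`
  (`{}^{s_r}p_r(s_r𝐢) = -p_r(𝐢)`, BK (3.23)), `bkPhi_mul_bkQs_mul_of_mem`,
  `ringInverse_bkQ_swap_mul_bkPhi_mul_of_mem`, `bkPsi_mul_bkPsi_mul_klrIdempotent_of_ne`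
  (**`ψ_r² e(𝐢) = (1 - p_r(𝐢)²)({}^{s_r}q_r(s_r𝐢))^{-1} q_r(𝐢)^{-1} e(𝐢)`**, BK p. 9), and
  `bkPsi_sq_mul_klrIdempotent` — **(R4) of Brundan–Kleshchev's Theorem 3.2 in all cases:
  `ψ_r² e(𝐢) = Q_{i_ri_{r+1}}(y_r, y_{r+1}) e(𝐢)`** (`0`, `1`, `y_{r+1} - y_r`, `y_r - y_{r+1}`,
  `(y_{r+1} - y_r)(y_r - y_{r+1})` according as `i_r = i_{r+1}`, unrelated, `i_r → i_{r+1}`,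
  `i_r ← i_{r+1}`, `i_r ⇄ i_{r+1}`).

* `bkNilpotent_pow_mul_klrIdempotent_eq_zero` — **the cyclotomic relation at level one**
  (`y_1 e(𝐢) = 0`, `e(𝐢) = 0` unless `i_1 = 0`); `bkPhi_mul_bkNilpotent_mul_of_mem_gen`,
  `bkPhi_mul_bkDiffUnit_mul_of_mem_gen`, `bkPhi_mul_bkP_mul_of_mem_gen`, `bkPhi_mul_bkQ_mul_of_mem_gen`,
  `bkPhi_mul_ringInverse_bkQ_mul_of_mem_gen` — **the general exchange rules `φ_r y_t w = y_{s_rt} φ_r w`,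
  `φ_r q_a(𝐣) w = q_{s_ra}(𝐣∘s_r) φ_r w` (any positions) on `M_𝐢`, `i_r ≠ i_{r+1}`** (Brundan–Kleshchev's
  (EDDR) in the `∂`-free case); `bkPsi_triple_mul_klrIdempotent_eq`
  (**`ψ_aψ_bψ_c e(𝐢) = φ_aφ_bφ_c q_{s_cs_ba}(𝐢)^{-1} q_{s_cb}(𝐢)^{-1} q_c(𝐢)^{-1} e(𝐢)`**) and
  `bkPsi_braid_of_ne` — **(R7) of BK Thm 3.2, Case 1: `ψ_rψ_{r+1}ψ_r e(𝐢) = ψ_{r+1}ψ_rψ_{r+1} e(𝐢)`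
  for `i_r, i_{r+1}, i_{r+2}` pairwise distinct.**

Beyond: the remaining cases of the `ψ`-braid relation (R7) of BK Theorem 3.2 (with their
`∂`-corrections), Theorem 3.3, §3.5, and Hu–Mathas §3.3–§5 (see the first sibling's docstring).

## References

* J. Hu, A. Mathas, *Graded cellular bases for the cyclotomic Khovanov–Lauda–Rouquier algebras of
  type A*, Adv. Math. 225 (2010) 598–642, arXiv:0907.2985, Main Theorem, Thm 24. [HuMathas2010]
* J. Brundan, A. Kleshchev, *Blocks of cyclotomic Hecke algebras and Khovanov–Lauda algebras*,
  Invent. Math. 178 (2009), arXiv:0808.2032, Lemma 3.1 — followed here; cited through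
  [HuMathas2010, Thm 24].
-/

noncomputable section

open scoped BigOperators

namespace Literature.RepresentationTheory.FiniteGroups

/-! ### (EI6), case `i_r = i_{r+1} ≠ i_{r+2}` (Brundan–Kleshchev Lemma 3.1, Case 2 of the proof) -/

section BKPhiBraidCase2

open Equiv

variable (k : Type*) [Field k] [DecidableEq k] {n : ℕ}

omit [DecidableEq k] in
/-- `(L_a - L_b) w = ((i_a - i_b) + y_a - y_b) w` for `w ∈ M_𝐢`. [folklore] -/
theorem jucysMurphy_sub_mul_of_mem [DecidableEq k] (a b : Fin n) {χ : Fin n → k}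
    {w : MonoidAlgebra k (Perm (Fin n))} (hw : w ∈ jointEigenspace k χ) :
    (jucysMurphy k a - jucysMurphy k b) * w = bkDiffUnit k a b (χ a - χ b) * w := by
  rw [← klrIdempotent_mul_of_mem k hw, ← mul_assoc, jucysMurphy_sub_mul_klrIdempotent, bkDiffUnit,
    mul_assoc]

omit [DecidableEq k] in
/-- `θ_r θ_{r+1} = s_r s_{r+1} x_{r,r+2} x_{r+1,r+2} + s_r x_{r,r+2} + s_{r+1} x_{r+1,r+2} + 1`.
[folklore] -/
theorem bkIntertwiner_mul_bkIntertwiner_succ {r r' r'' : Fin n} (h : (r' : ℕ) = r + 1)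
    (h' : (r'' : ℕ) = r' + 1) :
    bkIntertwiner k r r' * bkIntertwiner k r' r'' =
      MonoidAlgebra.of k _ (swap r r') * MonoidAlgebra.of k _ (swap r' r'') *
          ((jucysMurphy k r - jucysMurphy k r'') * (jucysMurphy k r' - jucysMurphy k r'')) +
        MonoidAlgebra.of k _ (swap r r') * (jucysMurphy k r - jucysMurphy k r'') +
        MonoidAlgebra.of k _ (swap r' r'') * (jucysMurphy k r' - jucysMurphy k r'') + 1 := by
  have hrr' : r ≠ r' := by intro e; rw [Fin.ext_iff] at e; omega
  have hrr'' : r ≠ r'' := by intro e; rw [Fin.ext_iff] at e; omega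
  have hUb : (jucysMurphy k r - jucysMurphy k r') * MonoidAlgebra.of k _ (swap r' r'') =
      MonoidAlgebra.of k _ (swap r' r'') * (jucysMurphy k r - jucysMurphy k r'') + 1 := by
    have h1 := of_swap_mul_jucysMurphy_of_ne k h' hrr' hrr''
    have h2 := of_swap_mul_jucysMurphy_succ k h'
    have h3 : jucysMurphy k r' * MonoidAlgebra.of k _ (swap r' r'') =
        MonoidAlgebra.of k _ (swap r' r'') * jucysMurphy k r'' - 1 := eq_sub_of_add_eq h2.symm
    rw [sub_mul, ← h1, mul_sub, h3]; abel
  rw [bkIntertwiner, bkIntertwiner]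
  calc (MonoidAlgebra.of k _ (swap r r') * (jucysMurphy k r - jucysMurphy k r') + 1) *
        (MonoidAlgebra.of k _ (swap r' r'') * (jucysMurphy k r' - jucysMurphy k r'') + 1)
      = MonoidAlgebra.of k _ (swap r r') *
          ((jucysMurphy k r - jucysMurphy k r') * MonoidAlgebra.of k _ (swap r' r'')) *
          (jucysMurphy k r' - jucysMurphy k r'') +
        MonoidAlgebra.of k _ (swap r r') * (jucysMurphy k r - jucysMurphy k r') +
        MonoidAlgebra.of k _ (swap r' r'') * (jucysMurphy k r' - jucysMurphy k r'') + 1 := by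
          noncomm_ring
    _ = _ := by rw [hUb]; noncomm_ring

/-- The ring-theoretic core of Case 2: with `P = (ab WV + aW + bV + 1) ι₁₃ ι₂₃` (`= θ₁θ₂ x_{13}^{-1}
x_{23}^{-1}`), `P (a + 1) e = (b + 1) P e`. Hypotheses: the degenerate affine Hecke relations
between `a = s_r` and `W = x_{r,r+2}`, `V = x_{r+1,r+2}`, the actions `W w = D₁₃ w`, `V w = D₂₃ w`
on `w ∈ {e, ae}`, inverses `ι` of the `D`'s, and the commutations available in `k[S_n]`.
[folklore] -/
theorem bk_braid_case2_aux {A : Type*} [Ring A] {a b W V D13 D23 ι13 ι23 e : A}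
    (haa : a * a = 1) (hbb : b * b = 1) (haba : a * b * a = b * a * b)
    (hWa : W * a = a * V - 1) (hVa : V * a = a * W + 1)
    (hWe : W * e = D13 * e) (hVe : V * e = D23 * e)
    (hWae : W * (a * e) = D13 * (a * e)) (hVae : V * (a * e) = D23 * (a * e))
    (hi13 : ι13 * D13 = 1) (hi13' : D13 * ι13 = 1) (hi23 : ι23 * D23 = 1) (hi23' : D23 * ι23 = 1)
    (cWV : W * V = V * W) (cιι : ι13 * ι23 = ι23 * ι13) (cι13e : ι13 * e = e * ι13)
    (cι23e : ι23 * e = e * ι23) (cWι13 : W * ι13 = ι13 * W) (cWι23 : W * ι23 = ι23 * W)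
    (cVι13 : V * ι13 = ι13 * V) (cVι23 : V * ι23 = ι23 * V) (cWD23 : W * D23 = D23 * W) :
    (a * b * (W * V) + a * W + b * V + 1) * (ι13 * ι23) * (a + 1) * e =
      (b + 1) * ((a * b * (W * V) + a * W + b * V + 1) * (ι13 * ι23)) * e := by
  -- cancellations on `e`
  have k1 : ι13 * ι23 * (W * V) * e = e := by
    calc ι13 * ι23 * (W * V) * e = ι13 * ι23 * W * (V * e) := by noncomm_ring
      _ = ι13 * ι23 * W * (D23 * e) := by rw [hVe]
      _ = ι13 * (ι23 * D23) * (W * e) := by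
          rw [← mul_assoc, mul_assoc (ι13 * ι23) W D23, cWD23]; noncomm_ring
      _ = e := by rw [hi23, mul_one, hWe, ← mul_assoc, hi13, one_mul]
  have k2 : ι13 * ι23 * W * e = ι23 * e := by
    rw [mul_assoc, hWe, cιι, mul_assoc, ← mul_assoc ι13, hi13, one_mul]
  have k3 : ι13 * ι23 * V * e = ι13 * e := by
    rw [mul_assoc, hVe, mul_assoc, ← mul_assoc ι23, hi23, one_mul]
  have eWV : (W * V) * (ι13 * ι23) = ι13 * ι23 * (W * V) := by
    rw [mul_assoc, mul_assoc, ← mul_assoc V, cVι13, mul_assoc, cVι23, ← mul_assoc,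
      ← mul_assoc, cWι13, mul_assoc ι13 W, cWι23]; noncomm_ring
  have eW : W * (ι13 * ι23) = ι13 * ι23 * W := by
    rw [← mul_assoc, cWι13, mul_assoc, cWι23, ← mul_assoc]
  have eV : V * (ι13 * ι23) = ι13 * ι23 * V := by
    rw [← mul_assoc, cVι13, mul_assoc, cVι23, ← mul_assoc]
  -- `P e`
  have hPe : (a * b * (W * V) + a * W + b * V + 1) * (ι13 * ι23) * e =
      a * b * e + a * (ι23 * e) + b * (ι13 * e) + ι13 * ι23 * e := by
    calc (a * b * (W * V) + a * W + b * V + 1) * (ι13 * ι23) * e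
        = a * b * ((W * V) * (ι13 * ι23) * e) + a * (W * (ι13 * ι23) * e) +
            b * (V * (ι13 * ι23) * e) + ι13 * ι23 * e := by noncomm_ring
      _ = a * b * (ι13 * ι23 * (W * V) * e) + a * (ι13 * ι23 * W * e) +
            b * (ι13 * ι23 * V * e) + ι13 * ι23 * e := by rw [eWV, eW, eV]
      _ = _ := by rw [k1, k2, k3]
  -- the key commutation `ι13 ι23 a e = a ι13 ι23 e`
  have hD13ae : D13 * (a * e) = a * (D23 * e) - e := by
    rw [← hWae, ← hVe, ← mul_assoc, hWa, sub_mul, one_mul, mul_assoc]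
  have hD23ae : D23 * (a * e) = a * (D13 * e) + e := by
    rw [← hVae, ← hWe, ← mul_assoc, hVa, add_mul, one_mul, mul_assoc]
  have R1 : ι13 * (a * e) = a * (ι23 * e) + ι13 * ι23 * e := by
    have step : a * e = ι13 * a * D23 * e - ι13 * e := by
      calc a * e = ι13 * (D13 * (a * e)) := by rw [← mul_assoc, hi13, one_mul]
        _ = _ := by rw [hD13ae]; noncomm_ring
    have key : a * (ι23 * e) = ι13 * (a * e) - ι13 * ι23 * e := by
      calc a * (ι23 * e) = a * e * ι23 := by rw [cι23e, mul_assoc]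
        _ = (ι13 * a * D23 * e - ι13 * e) * ι23 := by rw [step]
        _ = ι13 * a * (D23 * (e * ι23)) - ι13 * (e * ι23) := by noncomm_ring
        _ = ι13 * a * (D23 * (ι23 * e)) - ι13 * (ι23 * e) := by rw [← cι23e]
        _ = ι13 * (a * e) - ι13 * ι23 * e := by
            rw [← mul_assoc D23, hi23', one_mul]; noncomm_ring
    rw [key]; abel
  have R2 : ι23 * (a * e) = a * (ι13 * e) - ι23 * ι13 * e := by
    have step : a * e = ι23 * a * D13 * e + ι23 * e := by
      calc a * e = ι23 * (D23 * (a * e)) := by rw [← mul_assoc, hi23, one_mul]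
        _ = _ := by rw [hD23ae]; noncomm_ring
    have key : a * (ι13 * e) = ι23 * (a * e) + ι23 * ι13 * e := by
      calc a * (ι13 * e) = a * e * ι13 := by rw [cι13e, mul_assoc]
        _ = (ι23 * a * D13 * e + ι23 * e) * ι13 := by rw [step]
        _ = ι23 * a * (D13 * (e * ι13)) + ι23 * (e * ι13) := by noncomm_ring
        _ = ι23 * a * (D13 * (ι13 * e)) + ι23 * (ι13 * e) := by rw [← cι13e]
        _ = ι23 * (a * e) + ι23 * ι13 * e := by
            rw [← mul_assoc D13, hi13', one_mul]; noncomm_ring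
    rw [key]; abel
  have K : ι13 * ι23 * (a * e) = a * (ι13 * ι23 * e) := by
    calc ι13 * ι23 * (a * e) = ι13 * (ι23 * (a * e)) := by rw [mul_assoc]
      _ = ι13 * (a * (ι13 * e)) - ι13 * (ι23 * ι13 * e) := by rw [R2, mul_sub]
      _ = ι13 * (a * e) * ι13 - ι13 * ι23 * ι13 * e := by
          rw [cι13e, ← mul_assoc a, ← mul_assoc ι13 (a * e)]; noncomm_ring
      _ = (a * (ι23 * e) + ι13 * ι23 * e) * ι13 - ι13 * ι23 * ι13 * e := by rw [R1]
      _ = a * (ι23 * ι13 * e) := by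
          rw [add_mul, mul_assoc a, mul_assoc ι23 e, ← cι13e, mul_assoc (ι13 * ι23) e,
            ← cι13e]; noncomm_ring
      _ = _ := by rw [← cιι]
  -- `P a e`
  have hWVa : W * V * a = a * (V * W) := by
    rw [mul_assoc, hVa, mul_add, mul_one, ← mul_assoc, hWa]; noncomm_ring
  have hPae : (a * b * (W * V) + a * W + b * V + 1) * (ι13 * ι23) * (a * e) =
      a * b * a * e + ι13 * e + b * a * (ι23 * e) + b * (ι13 * ι23 * e) := by
    rw [mul_assoc, K]
    calc (a * b * (W * V) + a * W + b * V + 1) * (a * (ι13 * ι23 * e))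
        = a * b * (W * V * a) * (ι13 * ι23 * e) + a * (W * a) * (ι13 * ι23 * e) +
            b * (V * a) * (ι13 * ι23 * e) + a * (ι13 * ι23 * e) := by noncomm_ring
      _ = a * b * (a * (V * W)) * (ι13 * ι23 * e) + a * (a * V - 1) * (ι13 * ι23 * e) +
            b * (a * W + 1) * (ι13 * ι23 * e) + a * (ι13 * ι23 * e) := by rw [hWVa, hWa, hVa]
      _ = a * b * a * ((W * V) * (ι13 * ι23) * e) + (a * a) * (V * (ι13 * ι23) * e) +
            b * a * (W * (ι13 * ι23) * e) + b * (ι13 * ι23 * e) := by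
          rw [← cWV]; noncomm_ring
      _ = a * b * a * (ι13 * ι23 * (W * V) * e) + (a * a) * (ι13 * ι23 * V * e) +
            b * a * (ι13 * ι23 * W * e) + b * (ι13 * ι23 * e) := by rw [eWV, eW, eV]
      _ = _ := by rw [k1, k2, k3, haa, one_mul]
  -- assemble
  have lhs : (a * b * (W * V) + a * W + b * V + 1) * (ι13 * ι23) * (a + 1) * e =
      (a * b * (W * V) + a * W + b * V + 1) * (ι13 * ι23) * (a * e) +
        (a * b * (W * V) + a * W + b * V + 1) * (ι13 * ι23) * e := by noncomm_ring
  have rhs : (b + 1) * ((a * b * (W * V) + a * W + b * V + 1) * (ι13 * ι23)) * e =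
      b * ((a * b * (W * V) + a * W + b * V + 1) * (ι13 * ι23) * e) +
        (a * b * (W * V) + a * W + b * V + 1) * (ι13 * ι23) * e := by noncomm_ring
  rw [lhs, rhs, hPae, hPe]
  have hfin : b * (a * b * e + a * (ι23 * e) + b * (ι13 * e) + ι13 * ι23 * e) =
      b * a * b * e + b * a * (ι23 * e) + (b * b) * (ι13 * e) + b * (ι13 * ι23 * e) := by
    noncomm_ring
  rw [hfin, hbb, one_mul, haba]
  abel

/-- **(EI6), case `i_r = i_{r+1} ≠ i_{r+2}`: `φ_r φ_{r+1} φ_r e(𝐢) = φ_{r+1} φ_r φ_{r+1} e(𝐢)`**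
(Brundan–Kleshchev 2009, Lemma 3.1 (3.12), third case; Case 2 of the proof: both sides equal
`(s_{r+1}s_rs_{r+1} + s_{r+1}s_r x_{r+1,r+2}^{-1} + s_{r+1}x_{r+1,r+2}^{-1}x_{r,r+2}^{-1} + x_{r,r+2}^{-1}
+ φ_rφ_{r+1}) e(𝐢)`). [folklore] -/
theorem bkPhi_braid_of_eq_ne {r r' r'' : Fin n} (h : (r' : ℕ) = r + 1) (h' : (r'' : ℕ) = r' + 1)
    {χ : Fin n → k} (h1 : χ r = χ r') (h2 : χ r' ≠ χ r'') :
    bkPhi k r r' * bkPhi k r' r'' * bkPhi k r r' * klrIdempotent k χ =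
      bkPhi k r' r'' * bkPhi k r r' * bkPhi k r' r'' * klrIdempotent k χ := by
  have hrr' : r ≠ r' := by intro e; rw [Fin.ext_iff] at e; omega
  have hr'r'' : r' ≠ r'' := by intro e; rw [Fin.ext_iff] at e; omega
  have hrr'' : r ≠ r'' := by intro e; rw [Fin.ext_iff] at e; omega
  have h3 : χ r ≠ χ r'' := h1 ▸ h2
  have hc : χ r' - χ r'' ≠ 0 := sub_ne_zero.2 h2
  -- the six coefficients
  have hA1 : bkPhiCoeff k r r' χ = MonoidAlgebra.of k _ (swap r r') + 1 := by
    rw [bkPhiCoeff, if_pos h1]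
  have hA2 : bkPhiCoeff k r' r'' (χ ∘ swap r r') =
      bkIntertwiner k r' r'' * Ring.inverse (bkDiffUnit k r' r'' (χ r' - χ r'')) := by
    have e1 : (χ ∘ swap r r') r' = χ r := by simp [swap_apply_right]
    have e2 : (χ ∘ swap r r') r'' = χ r'' := by
      simp [swap_apply_of_ne_of_ne (Ne.symm hrr'') (Ne.symm hr'r'')]
    rw [bkPhiCoeff, e1, e2, if_neg h3, h1]
  have hA3 : bkPhiCoeff k r r' ((χ ∘ swap r r') ∘ swap r' r'') =
      bkIntertwiner k r r' * Ring.inverse (bkDiffUnit k r r' (χ r' - χ r'')) := by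
    have e1 : ((χ ∘ swap r r') ∘ swap r' r'') r = χ r' := by
      simp [swap_apply_of_ne_of_ne hrr' hrr'', swap_apply_left]
    have e2 : ((χ ∘ swap r r') ∘ swap r' r'') r' = χ r'' := by
      simp [swap_apply_left, swap_apply_of_ne_of_ne (Ne.symm hrr'') (Ne.symm hr'r'')]
    rw [bkPhiCoeff, e1, e2, if_neg h2]
  have hB1 : bkPhiCoeff k r' r'' χ =
      bkIntertwiner k r' r'' * Ring.inverse (bkDiffUnit k r' r'' (χ r' - χ r'')) := by
    rw [bkPhiCoeff, if_neg h2]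
  have hB2 : bkPhiCoeff k r r' (χ ∘ swap r' r'') =
      bkIntertwiner k r r' * Ring.inverse (bkDiffUnit k r r' (χ r' - χ r'')) := by
    have e1 : (χ ∘ swap r' r'') r = χ r := by simp [swap_apply_of_ne_of_ne hrr' hrr'']
    have e2 : (χ ∘ swap r' r'') r' = χ r'' := by simp [swap_apply_left]
    rw [bkPhiCoeff, e1, e2, if_neg h3, h1]
  have hB3 : bkPhiCoeff k r' r'' ((χ ∘ swap r' r'') ∘ swap r r') =
      MonoidAlgebra.of k _ (swap r' r'') + 1 := by
    have e1 : ((χ ∘ swap r' r'') ∘ swap r r') r' = χ r := by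
      simp [swap_apply_right, swap_apply_of_ne_of_ne hrr' hrr'']
    have e2 : ((χ ∘ swap r' r'') ∘ swap r r') r'' = χ r' := by
      simp [swap_apply_of_ne_of_ne (Ne.symm hrr'') (Ne.symm hr'r''), swap_apply_right]
    rw [bkPhiCoeff, e1, e2, if_pos h1]
  rw [bkPhi_triple_mul_klrIdempotent_eq k h' h, bkPhi_triple_mul_klrIdempotent_eq k h h',
    hA1, hA2, hA3, hB1, hB2, hB3]
  -- `ι12(c) θ₂ = θ₂ ι13(c)`, so both sides involve `θ₁ θ₂ ι13 ι23`
  have hmove : Ring.inverse (bkDiffUnit k r r' (χ r' - χ r'')) * bkIntertwiner k r' r'' =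
      bkIntertwiner k r' r'' * Ring.inverse (bkDiffUnit k r r'' (χ r' - χ r'')) := by
    rw [ringInverse_bkDiffUnit_mul_bkIntertwiner k h' r r' hc,
      swap_apply_of_ne_of_ne hrr' hrr'', swap_apply_left]
  have hP : bkIntertwiner k r r' * Ring.inverse (bkDiffUnit k r r' (χ r' - χ r'')) *
      (bkIntertwiner k r' r'' * Ring.inverse (bkDiffUnit k r' r'' (χ r' - χ r''))) =
      (bkIntertwiner k r r' * bkIntertwiner k r' r'') *
        (Ring.inverse (bkDiffUnit k r r'' (χ r' - χ r'')) *
          Ring.inverse (bkDiffUnit k r' r'' (χ r' - χ r''))) := by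
    rw [← mul_assoc, mul_assoc (bkIntertwiner k r r'), hmove]; noncomm_ring
  rw [hP, mul_assoc (MonoidAlgebra.of k _ (swap r' r'') + 1) (bkIntertwiner k r r' * _), hP,
    bkIntertwiner_mul_bkIntertwiner_succ k h h']
  -- hypotheses of the abstract lemma
  have hu13 := isUnit_bkDiffUnit k r r'' hc
  have hu23 := isUnit_bkDiffUnit k r' r'' hc
  have hae : MonoidAlgebra.of k _ (swap r r') * klrIdempotent k χ ∈ jointEigenspace k χ :=
    of_swap_mul_klrIdempotent_mem k h h1
  have hWe : (jucysMurphy k r - jucysMurphy k r'') * klrIdempotent k χ =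
      bkDiffUnit k r r'' (χ r' - χ r'') * klrIdempotent k χ := by
    have := jucysMurphy_sub_mul_of_mem k r r'' (klrIdempotent_mem k χ)
    rwa [h1] at this
  have hWae : (jucysMurphy k r - jucysMurphy k r'') *
      (MonoidAlgebra.of k _ (swap r r') * klrIdempotent k χ) =
      bkDiffUnit k r r'' (χ r' - χ r'') * (MonoidAlgebra.of k _ (swap r r') * klrIdempotent k χ) := by
    have := jucysMurphy_sub_mul_of_mem k r r'' hae
    rwa [h1] at this
  have hWa : (jucysMurphy k r - jucysMurphy k r'') * MonoidAlgebra.of k _ (swap r r') =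
      MonoidAlgebra.of k _ (swap r r') * (jucysMurphy k r' - jucysMurphy k r'') - 1 := by
    have e1 := of_swap_mul_jucysMurphy_succ k h
    have e2 := of_swap_mul_jucysMurphy_of_ne k h (Ne.symm hrr'') (Ne.symm hr'r'')
    have e3 : jucysMurphy k r * MonoidAlgebra.of k _ (swap r r') =
        MonoidAlgebra.of k _ (swap r r') * jucysMurphy k r' - 1 := eq_sub_of_add_eq e1.symm
    rw [sub_mul, e3, ← e2, mul_sub]; abel
  have hVa : (jucysMurphy k r' - jucysMurphy k r'') * MonoidAlgebra.of k _ (swap r r') =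
      MonoidAlgebra.of k _ (swap r r') * (jucysMurphy k r - jucysMurphy k r'') + 1 := by
    have e1 := jucysMurphy_succ_mul_swap k h
    have e2 := of_swap_mul_jucysMurphy_of_ne k h (Ne.symm hrr'') (Ne.symm hr'r'')
    rw [sub_mul, e1, ← e2, mul_sub]; abel
  have haba : MonoidAlgebra.of k (Perm (Fin n)) (swap r r') * MonoidAlgebra.of k _ (swap r' r'') *
      MonoidAlgebra.of k _ (swap r r') =
      MonoidAlgebra.of k _ (swap r' r'') * MonoidAlgebra.of k _ (swap r r') *
        MonoidAlgebra.of k _ (swap r' r'') := by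
    rw [← map_mul, ← map_mul, ← map_mul, ← map_mul]
    congr 1
    rw [swap_mul_swap_mul_swap hrr' hrr'', swap_comm r r', swap_comm r' r'',
      swap_mul_swap_mul_swap (Ne.symm hr'r'') (Ne.symm hrr''), swap_comm]
  have hL := fun a b : Fin n => commute_jucysMurphy k a b
  have cW13 := (commute_jucysMurphy_bkDiffUnit k r r r'' (χ r' - χ r'')).sub_left
      (commute_jucysMurphy_bkDiffUnit k r'' r r'' (χ r' - χ r''))
  have cW23 := (commute_jucysMurphy_bkDiffUnit k r r' r'' (χ r' - χ r'')).sub_left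
      (commute_jucysMurphy_bkDiffUnit k r'' r' r'' (χ r' - χ r''))
  have cV13 := (commute_jucysMurphy_bkDiffUnit k r' r r'' (χ r' - χ r'')).sub_left
      (commute_jucysMurphy_bkDiffUnit k r'' r r'' (χ r' - χ r''))
  have cV23 := (commute_jucysMurphy_bkDiffUnit k r' r' r'' (χ r' - χ r'')).sub_left
      (commute_jucysMurphy_bkDiffUnit k r'' r' r'' (χ r' - χ r''))
  exact bk_braid_case2_aux (of_swap_mul_self k r r') (of_swap_mul_self k r' r'') haba hWa hVa hWe
    (jucysMurphy_sub_mul_of_mem k r' r'' (klrIdempotent_mem k χ)) hWae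
    (jucysMurphy_sub_mul_of_mem k r' r'' hae)
    (Ring.inverse_mul_cancel _ hu13) (Ring.mul_inverse_cancel _ hu13)
    (Ring.inverse_mul_cancel _ hu23) (Ring.mul_inverse_cancel _ hu23)
    (((hL r r').sub_left (hL r'' r')).sub_right ((hL r r'').sub_left (hL r'' r''))).eq
    ((commute_bkDiffUnit k r r'' r' r'' _ _).ringInverse_ringInverse).eq
    (commute_ringInverse_of_commute (commute_klrIdempotent_bkDiffUnit k χ r r'' _) hu13).symm.eq
    (commute_ringInverse_of_commute (commute_klrIdempotent_bkDiffUnit k χ r' r'' _) hu23).symm.eq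
    (commute_ringInverse_of_commute cW13 hu13).eq (commute_ringInverse_of_commute cW23 hu23).eq
    (commute_ringInverse_of_commute cV13 hu13).eq (commute_ringInverse_of_commute cV23 hu23).eq
    cW23.eq

end BKPhiBraidCase2

/-! ### (EI6), case `i_r ≠ i_{r+1} = i_{r+2}` (Brundan–Kleshchev Lemma 3.1, Case 3 of the proof) -/

section BKPhiBraidCase3

open Equiv

variable (k : Type*) [Field k] [DecidableEq k] {n : ℕ}

omit [DecidableEq k] in
/-- `θ_{r+1} θ_r = s_{r+1} s_r x_{r,r+2} x_{r,r+1} + s_{r+1} x_{r,r+2} + s_r x_{r,r+1} + 1`.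
[folklore] -/
theorem bkIntertwiner_succ_mul_bkIntertwiner {r r' r'' : Fin n} (h : (r' : ℕ) = r + 1)
    (h' : (r'' : ℕ) = r' + 1) :
    bkIntertwiner k r' r'' * bkIntertwiner k r r' =
      MonoidAlgebra.of k _ (swap r' r'') * MonoidAlgebra.of k _ (swap r r') *
          ((jucysMurphy k r - jucysMurphy k r'') * (jucysMurphy k r - jucysMurphy k r')) +
        MonoidAlgebra.of k _ (swap r' r'') * (jucysMurphy k r - jucysMurphy k r'') +
        MonoidAlgebra.of k _ (swap r r') * (jucysMurphy k r - jucysMurphy k r') + 1 := by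
  have hr'r'' : r' ≠ r'' := by intro e; rw [Fin.ext_iff] at e; omega
  have hrr'' : r ≠ r'' := by intro e; rw [Fin.ext_iff] at e; omega
  have hVa : (jucysMurphy k r' - jucysMurphy k r'') * MonoidAlgebra.of k _ (swap r r') =
      MonoidAlgebra.of k _ (swap r r') * (jucysMurphy k r - jucysMurphy k r'') + 1 := by
    have e1 := jucysMurphy_succ_mul_swap k h
    have e2 := of_swap_mul_jucysMurphy_of_ne k h (Ne.symm hrr'') (Ne.symm hr'r'')
    rw [sub_mul, e1, ← e2, mul_sub]; abel
  rw [bkIntertwiner, bkIntertwiner]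
  calc (MonoidAlgebra.of k _ (swap r' r'') * (jucysMurphy k r' - jucysMurphy k r'') + 1) *
        (MonoidAlgebra.of k _ (swap r r') * (jucysMurphy k r - jucysMurphy k r') + 1)
      = MonoidAlgebra.of k _ (swap r' r'') *
          ((jucysMurphy k r' - jucysMurphy k r'') * MonoidAlgebra.of k _ (swap r r')) *
          (jucysMurphy k r - jucysMurphy k r') +
        MonoidAlgebra.of k _ (swap r' r'') * (jucysMurphy k r' - jucysMurphy k r'') +
        MonoidAlgebra.of k _ (swap r r') * (jucysMurphy k r - jucysMurphy k r') + 1 := by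
          noncomm_ring
    _ = _ := by rw [hVa]; noncomm_ring

/-- **(EI6), case `i_r ≠ i_{r+1} = i_{r+2}`: `φ_r φ_{r+1} φ_r e(𝐢) = φ_{r+1} φ_r φ_{r+1} e(𝐢)`**
(Brundan–Kleshchev 2009, Lemma 3.1 (3.12), third case; Case 3 of the proof, the mirror image of
Case 2 — here literally the same ring lemma with `s_r ↔ s_{r+1}`, `x_{r+1,r+2} ↔ x_{r,r+1}`).
[folklore] -/
theorem bkPhi_braid_of_ne_eq {r r' r'' : Fin n} (h : (r' : ℕ) = r + 1) (h' : (r'' : ℕ) = r' + 1)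
    {χ : Fin n → k} (h1 : χ r ≠ χ r') (h2 : χ r' = χ r'') :
    bkPhi k r r' * bkPhi k r' r'' * bkPhi k r r' * klrIdempotent k χ =
      bkPhi k r' r'' * bkPhi k r r' * bkPhi k r' r'' * klrIdempotent k χ := by
  have hrr' : r ≠ r' := by intro e; rw [Fin.ext_iff] at e; omega
  have hr'r'' : r' ≠ r'' := by intro e; rw [Fin.ext_iff] at e; omega
  have hrr'' : r ≠ r'' := by intro e; rw [Fin.ext_iff] at e; omega
  have h3 : χ r ≠ χ r'' := h2 ▸ h1
  have hc : χ r - χ r' ≠ 0 := sub_ne_zero.2 h1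
  -- the six coefficients
  have hA1 : bkPhiCoeff k r r' χ =
      bkIntertwiner k r r' * Ring.inverse (bkDiffUnit k r r' (χ r - χ r')) := by
    rw [bkPhiCoeff, if_neg h1]
  have hA2 : bkPhiCoeff k r' r'' (χ ∘ swap r r') =
      bkIntertwiner k r' r'' * Ring.inverse (bkDiffUnit k r' r'' (χ r - χ r')) := by
    have e1 : (χ ∘ swap r r') r' = χ r := by simp [swap_apply_right]
    have e2 : (χ ∘ swap r r') r'' = χ r'' := by
      simp [swap_apply_of_ne_of_ne (Ne.symm hrr'') (Ne.symm hr'r'')]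
    rw [bkPhiCoeff, e1, e2, if_neg h3, ← h2]
  have hA3 : bkPhiCoeff k r r' ((χ ∘ swap r r') ∘ swap r' r'') =
      MonoidAlgebra.of k _ (swap r r') + 1 := by
    have e1 : ((χ ∘ swap r r') ∘ swap r' r'') r = χ r' := by
      simp [swap_apply_of_ne_of_ne hrr' hrr'', swap_apply_left]
    have e2 : ((χ ∘ swap r r') ∘ swap r' r'') r' = χ r'' := by
      simp [swap_apply_left, swap_apply_of_ne_of_ne (Ne.symm hrr'') (Ne.symm hr'r'')]
    rw [bkPhiCoeff, e1, e2, if_pos h2]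
  have hB1 : bkPhiCoeff k r' r'' χ = MonoidAlgebra.of k _ (swap r' r'') + 1 := by
    rw [bkPhiCoeff, if_pos h2]
  have hB2 : bkPhiCoeff k r r' (χ ∘ swap r' r'') =
      bkIntertwiner k r r' * Ring.inverse (bkDiffUnit k r r' (χ r - χ r')) := by
    have e1 : (χ ∘ swap r' r'') r = χ r := by simp [swap_apply_of_ne_of_ne hrr' hrr'']
    have e2 : (χ ∘ swap r' r'') r' = χ r'' := by simp [swap_apply_left]
    rw [bkPhiCoeff, e1, e2, if_neg h3, ← h2]
  have hB3 : bkPhiCoeff k r' r'' ((χ ∘ swap r' r'') ∘ swap r r') =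
      bkIntertwiner k r' r'' * Ring.inverse (bkDiffUnit k r' r'' (χ r - χ r')) := by
    have e1 : ((χ ∘ swap r' r'') ∘ swap r r') r' = χ r := by
      simp [swap_apply_right, swap_apply_of_ne_of_ne hrr' hrr'']
    have e2 : ((χ ∘ swap r' r'') ∘ swap r r') r'' = χ r' := by
      simp [swap_apply_of_ne_of_ne (Ne.symm hrr'') (Ne.symm hr'r''), swap_apply_right]
    rw [bkPhiCoeff, e1, e2, if_neg h1]
  rw [bkPhi_triple_mul_klrIdempotent_eq k h' h, bkPhi_triple_mul_klrIdempotent_eq k h h',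
    hA1, hA2, hA3, hB1, hB2, hB3]
  -- `ι23(c) θ₁ = θ₁ ι13(c)`
  have hmove : Ring.inverse (bkDiffUnit k r' r'' (χ r - χ r')) * bkIntertwiner k r r' =
      bkIntertwiner k r r' * Ring.inverse (bkDiffUnit k r r'' (χ r - χ r')) := by
    rw [ringInverse_bkDiffUnit_mul_bkIntertwiner k h r' r'' hc, swap_apply_right,
      swap_apply_of_ne_of_ne (Ne.symm hrr'') (Ne.symm hr'r'')]
  have hQ : bkIntertwiner k r' r'' * Ring.inverse (bkDiffUnit k r' r'' (χ r - χ r')) *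
      (bkIntertwiner k r r' * Ring.inverse (bkDiffUnit k r r' (χ r - χ r'))) =
      (bkIntertwiner k r' r'' * bkIntertwiner k r r') *
        (Ring.inverse (bkDiffUnit k r r'' (χ r - χ r')) *
          Ring.inverse (bkDiffUnit k r r' (χ r - χ r'))) := by
    rw [← mul_assoc, mul_assoc (bkIntertwiner k r' r''), hmove]; noncomm_ring
  rw [mul_assoc (MonoidAlgebra.of k _ (swap r r') + 1) (bkIntertwiner k r' r'' * _), hQ,
    bkIntertwiner_succ_mul_bkIntertwiner k h h']
  -- hypotheses of the abstract lemma (roles of `s_r`, `s_{r+1}` exchanged)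
  have hu13 := isUnit_bkDiffUnit k r r'' hc
  have hu12 := isUnit_bkDiffUnit k r r' hc
  have hbe : MonoidAlgebra.of k _ (swap r' r'') * klrIdempotent k χ ∈ jointEigenspace k χ :=
    of_swap_mul_klrIdempotent_mem k h' h2
  have hWe : (jucysMurphy k r - jucysMurphy k r'') * klrIdempotent k χ =
      bkDiffUnit k r r'' (χ r - χ r') * klrIdempotent k χ := by
    have := jucysMurphy_sub_mul_of_mem k r r'' (klrIdempotent_mem k χ)
    rwa [← h2] at this
  have hWbe : (jucysMurphy k r - jucysMurphy k r'') *
      (MonoidAlgebra.of k _ (swap r' r'') * klrIdempotent k χ) =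
      bkDiffUnit k r r'' (χ r - χ r') * (MonoidAlgebra.of k _ (swap r' r'') * klrIdempotent k χ) := by
    have := jucysMurphy_sub_mul_of_mem k r r'' hbe
    rwa [← h2] at this
  have hWb : (jucysMurphy k r - jucysMurphy k r'') * MonoidAlgebra.of k _ (swap r' r'') =
      MonoidAlgebra.of k _ (swap r' r'') * (jucysMurphy k r - jucysMurphy k r') - 1 := by
    have e1 := of_swap_mul_jucysMurphy_of_ne k h' hrr' hrr''
    have e2 := jucysMurphy_succ_mul_swap k h'
    rw [sub_mul, ← e1, e2, mul_sub]; abel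
  have hUb : (jucysMurphy k r - jucysMurphy k r') * MonoidAlgebra.of k _ (swap r' r'') =
      MonoidAlgebra.of k _ (swap r' r'') * (jucysMurphy k r - jucysMurphy k r'') + 1 := by
    have e1 := of_swap_mul_jucysMurphy_of_ne k h' hrr' hrr''
    have e2 := of_swap_mul_jucysMurphy_succ k h'
    have e3 : jucysMurphy k r' * MonoidAlgebra.of k _ (swap r' r'') =
        MonoidAlgebra.of k _ (swap r' r'') * jucysMurphy k r'' - 1 := eq_sub_of_add_eq e2.symm
    rw [sub_mul, ← e1, mul_sub, e3]; abel
  have hbab : MonoidAlgebra.of k (Perm (Fin n)) (swap r' r'') * MonoidAlgebra.of k _ (swap r r') *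
      MonoidAlgebra.of k _ (swap r' r'') =
      MonoidAlgebra.of k _ (swap r r') * MonoidAlgebra.of k _ (swap r' r'') *
        MonoidAlgebra.of k _ (swap r r') := by
    rw [← map_mul, ← map_mul, ← map_mul, ← map_mul]
    congr 1
    rw [swap_mul_swap_mul_swap hrr' hrr'', swap_comm r r', swap_comm r' r'',
      swap_mul_swap_mul_swap (Ne.symm hr'r'') (Ne.symm hrr''), swap_comm]
  have hL := fun a b : Fin n => commute_jucysMurphy k a b
  have cW13 := (commute_jucysMurphy_bkDiffUnit k r r r'' (χ r - χ r')).sub_left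
      (commute_jucysMurphy_bkDiffUnit k r'' r r'' (χ r - χ r'))
  have cW12 := (commute_jucysMurphy_bkDiffUnit k r r r' (χ r - χ r')).sub_left
      (commute_jucysMurphy_bkDiffUnit k r'' r r' (χ r - χ r'))
  have cU13 := (commute_jucysMurphy_bkDiffUnit k r r r'' (χ r - χ r')).sub_left
      (commute_jucysMurphy_bkDiffUnit k r' r r'' (χ r - χ r'))
  have cU12 := (commute_jucysMurphy_bkDiffUnit k r r r' (χ r - χ r')).sub_left
      (commute_jucysMurphy_bkDiffUnit k r' r r' (χ r - χ r'))
  exact (bk_braid_case2_aux (of_swap_mul_self k r' r'') (of_swap_mul_self k r r') hbab hWb hUb hWe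
    (jucysMurphy_sub_mul_of_mem k r r' (klrIdempotent_mem k χ)) hWbe
    (jucysMurphy_sub_mul_of_mem k r r' hbe)
    (Ring.inverse_mul_cancel _ hu13) (Ring.mul_inverse_cancel _ hu13)
    (Ring.inverse_mul_cancel _ hu12) (Ring.mul_inverse_cancel _ hu12)
    (((hL r r).sub_left (hL r'' r)).sub_right ((hL r r').sub_left (hL r'' r'))).eq
    ((commute_bkDiffUnit k r r'' r r' _ _).ringInverse_ringInverse).eq
    (commute_ringInverse_of_commute (commute_klrIdempotent_bkDiffUnit k χ r r'' _) hu13).symm.eq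
    (commute_ringInverse_of_commute (commute_klrIdempotent_bkDiffUnit k χ r r' _) hu12).symm.eq
    (commute_ringInverse_of_commute cW13 hu13).eq (commute_ringInverse_of_commute cW12 hu12).eq
    (commute_ringInverse_of_commute cU13 hu13).eq (commute_ringInverse_of_commute cU12 hu12).eq
    ((commute_jucysMurphy_bkDiffUnit k r r r' (χ r - χ r')).sub_left
      (commute_jucysMurphy_bkDiffUnit k r'' r r' (χ r - χ r'))).eq).symm

end BKPhiBraidCase3


/-! ### (EI6), case `i_r = i_{r+2} ≠ i_{r+1}` (Brundan–Kleshchev Lemma 3.1, Case 4 of the proof) -/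

section BKPhiBraidCase4

open Equiv

/-- The ring-theoretic core of Case 4 (Brundan–Kleshchev's expansion of `φ_{r+1}φ_rφ_{r+1} e(𝐢)`
for `𝐢 = (…, i, j, i, …)`, p. 8): with `θ = bV + 1` (`= θ_{r+1}`), `θ² = 1 - V²`, `V a = a W + 1`,
`W θ = θ U`, the actions `U e = D₁₂ e`, `V e = D₂₃ e` with left inverses `u`, `v` of `D₁₂`, `D₂₃`,
the moves `w' θ = θ u`, `v' θ = -θ v`, and `V (a w₁) = D₂₃' (a w₁)`, `W w₁ = D₁₃' w₁` for
`w₁ = w' θ v e`:  `θ v' (a + 1) θ v e = (bab + ba v + ab u + b uv + a uv + u v² - v² + 1) e`.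
[folklore] -/
theorem bk_braid_case4_aux {A : Type*} [Ring A]
    {a b V W U θ D12 D23 D23' D13' u v v' w' e : A}
    (hθ : θ = b * V + 1) (hθθ : θ * θ = 1 - V * V) (hbb : b * b = 1)
    (hVa : V * a = a * W + 1) (hWθ : W * θ = θ * U)
    (hUe : U * e = D12 * e) (hVe : V * e = D23 * e)
    (hu : u * D12 = 1) (hv : v * D23 = 1)
    (hw'θ : w' * θ = θ * u) (hv'θ : v' * θ = -(θ * v))
    (hVaw₁ : V * (a * (w' * (θ * (v * e)))) = D23' * (a * (w' * (θ * (v * e)))))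
    (hWw₁ : W * (w' * (θ * (v * e))) = D13' * (w' * (θ * (v * e))))
    (hv'D : v' * D23' = 1) (hD13'w' : D13' * w' = 1)
    (cUu : U * u = u * U) (cUv : U * v = v * U) (cVu : V * u = u * V) (cVv : V * v = v * V)
    (cuv : u * v = v * u) :
    θ * v' * (a + 1) * (θ * (v * e)) =
      (b * a * b + b * a * v + a * b * u + b * (u * v) + a * (u * v) + u * (v * v) - v * v + 1) *
        e := by
  -- `R2`: `v' a w = a w' w - v' w' w` for `w = θ v e`
  have R2 : v' * (a * (θ * (v * e))) =
      a * (w' * (θ * (v * e))) - v' * (w' * (θ * (v * e))) := by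
    have h1 : D23' * (a * (w' * (θ * (v * e)))) =
        a * (θ * (v * e)) + w' * (θ * (v * e)) := by
      rw [← hVaw₁, ← mul_assoc, hVa, add_mul, one_mul, mul_assoc, hWw₁, ← mul_assoc D13',
        hD13'w', one_mul]
    have h2 : a * (w' * (θ * (v * e))) =
        v' * (a * (θ * (v * e))) + v' * (w' * (θ * (v * e))) := by
      calc a * (w' * (θ * (v * e))) = v' * (D23' * (a * (w' * (θ * (v * e))))) := by
            rw [← mul_assoc v', hv'D, one_mul]
        _ = _ := by rw [h1, mul_add]
    rw [h2]; abel
  -- cancellations (everything stays to the left of `e`)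
  have k1 : V * (v * e) = e := by rw [← mul_assoc, cVv, mul_assoc, hVe, ← mul_assoc, hv, one_mul]
  have k2 : V * (u * (v * e)) = u * e := by rw [← mul_assoc, cVu, mul_assoc, k1]
  have k3 : U * (u * (v * e)) = v * e := by
    rw [← mul_assoc, cUu, mul_assoc, ← mul_assoc U v, cUv, mul_assoc, hUe, ← mul_assoc u v, cuv,
      mul_assoc, ← mul_assoc u, hu, one_mul]
  have k4 : V * (V * (v * (v * e))) = e := by
    rw [← mul_assoc V v, cVv, mul_assoc, k1, k1]
  have k5 : V * (V * (u * (v * (v * e)))) = u * e := by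
    rw [← mul_assoc V u, cVu, mul_assoc, ← mul_assoc V u, cVu, mul_assoc, k4]
  -- `θ a θ = b a θ U + b θ + a θ`
  have hθaθ : θ * a * θ = b * a * θ * U + b * θ + a * θ := by
    have hθa : θ * a = b * a * W + b + a := by
      rw [hθ, add_mul, one_mul, mul_assoc, hVa, mul_add, mul_one, ← mul_assoc]
    rw [hθa, add_mul, add_mul, mul_assoc (b * a) W θ, hWθ, ← mul_assoc]
  -- the two terms of `θ v' (a + 1) θ v e`
  have T2 : θ * v' * (θ * (v * e)) = -(v * (v * e)) + e := by
    calc θ * v' * (θ * (v * e)) = θ * (v' * θ) * (v * e) := by noncomm_ring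
      _ = -(θ * θ) * (v * (v * e)) := by rw [hv'θ]; noncomm_ring
      _ = -(v * (v * e)) + V * (V * (v * (v * e))) := by rw [hθθ]; noncomm_ring
      _ = _ := by rw [k4]
  have T1 : θ * v' * a * (θ * (v * e)) =
      b * a * b * e + b * a * (v * e) + b * (u * (v * e)) + a * b * (u * e) + a * (u * (v * e)) +
        u * (v * (v * e)) := by
    have step1 : θ * v' * a * (θ * (v * e)) =
        θ * a * θ * (u * (v * e)) + θ * θ * (v * (u * (v * e))) := by
      calc θ * v' * a * (θ * (v * e)) = θ * (v' * (a * (θ * (v * e)))) := by noncomm_ring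
        _ = θ * (a * ((w' * θ) * (v * e))) - θ * ((v' * (w' * θ)) * (v * e)) := by
            rw [R2]; noncomm_ring
        _ = θ * (a * ((θ * u) * (v * e))) - θ * ((v' * (θ * u)) * (v * e)) := by rw [hw'θ]
        _ = θ * (a * ((θ * u) * (v * e))) - θ * (((v' * θ) * u) * (v * e)) := by noncomm_ring
        _ = θ * (a * ((θ * u) * (v * e))) - θ * (((-(θ * v)) * u) * (v * e)) := by rw [hv'θ]
        _ = _ := by noncomm_ring
    have hvuv : v * (u * (v * e)) = u * (v * (v * e)) := by rw [← mul_assoc, ← cuv, mul_assoc]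
    rw [step1, hθaθ, hθθ, hvuv]
    calc (b * a * θ * U + b * θ + a * θ) * (u * (v * e)) + (1 - V * V) * (u * (v * (v * e)))
        = b * a * θ * (U * (u * (v * e))) + b * (θ * (u * (v * e))) + a * (θ * (u * (v * e))) +
            u * (v * (v * e)) - V * (V * (u * (v * (v * e)))) := by noncomm_ring
      _ = b * a * θ * (v * e) + b * (θ * (u * (v * e))) + a * (θ * (u * (v * e))) +
            u * (v * (v * e)) - u * e := by rw [k3, k5]
      _ = b * a * (b * (V * (v * e)) + v * e) + b * (b * (V * (u * (v * e))) + u * (v * e)) +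
            a * (b * (V * (u * (v * e))) + u * (v * e)) + u * (v * (v * e)) - u * e := by
          rw [hθ]; noncomm_ring
      _ = b * a * (b * e + v * e) + b * (b * (u * e) + u * (v * e)) +
            a * (b * (u * e) + u * (v * e)) + u * (v * (v * e)) - u * e := by rw [k1, k2]
      _ = b * a * b * e + b * a * (v * e) + (b * b) * (u * e) + b * (u * (v * e)) +
            a * b * (u * e) + a * (u * (v * e)) + u * (v * (v * e)) - u * e := by noncomm_ring
      _ = _ := by rw [hbb]; noncomm_ring
  calc θ * v' * (a + 1) * (θ * (v * e))
      = θ * v' * a * (θ * (v * e)) + θ * v' * (θ * (v * e)) := by noncomm_ring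
    _ = _ := by rw [T1, T2]; noncomm_ring

/-- The final bookkeeping of Case 4: the two expansions differ by Brundan–Kleshchev's `z_r`,
given `aba = bab` and `uv = vu`. [folklore] -/
theorem bk_braid_case4_combine {A : Type*} [Ring A] {a b u v : A} (haba : a * b * a = b * a * b)
    (cuv : u * v = v * u) :
    a * b * a + a * b * u + b * a * v + a * (v * u) + b * (v * u) + v * (u * u) - u * u + 1 =
      b * a * b + b * a * v + a * b * u + b * (u * v) + a * (u * v) + u * (v * v) - v * v + 1 +
        (u - v) * (u * v - u - v) := by
  have key : a * b * a + a * b * u + b * a * v + a * (v * u) + b * (v * u) + v * (u * u) - u * u + 1 -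
      (b * a * b + b * a * v + a * b * u + b * (u * v) + a * (u * v) + u * (v * v) - v * v + 1 +
        (u - v) * (u * v - u - v)) =
      (a * b * a - b * a * b) + a * (v * u - u * v) + b * (v * u - u * v) +
        (v * u - u * v) * u + u * (v * u - u * v) + (v * u - u * v) * v - (v * u - u * v) := by
    noncomm_ring
  rw [haba, cuv, sub_self, sub_self] at key
  rw [haba, cuv]
  exact sub_eq_zero.1 (by simpa using key)

end BKPhiBraidCase4

section BKPhiBraidCase4Concrete

open Equiv

variable (k : Type*) [Field k] [DecidableEq k] {n : ℕ}

omit [DecidableEq k] in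
/-- For `i_r = i_{r+1}`, `s_r M_𝐢 ⊆ M_𝐢`. [folklore] -/
theorem of_swap_mul_mem_of_eq {r r' : Fin n} (h : (r' : ℕ) = r + 1) {χ : Fin n → k}
    (hχ : χ r = χ r') {v : MonoidAlgebra k (Perm (Fin n))} (hv : v ∈ jointEigenspace k χ) :
    MonoidAlgebra.of k _ (swap r r') * v ∈ jointEigenspace k χ := by
  have hfix : χ ∘ swap r r' = χ := by
    funext x
    simp only [Function.comp_apply]
    by_cases h1 : x = r
    · subst h1; rw [swap_apply_left, hχ]
    by_cases h2 : x = r'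
    · subst h2; rw [swap_apply_right, hχ]
    rw [swap_apply_of_ne_of_ne h1 h2]
  have hmem := of_swap_mul_mem_sup_jointEigenspace k h hv
  rwa [hfix, sup_idem] at hmem

/-- One side of Case 4, concretely: for `i_p = i_{p''}` ... we package the instantiation of
`bk_braid_case4_aux` for the triple `(r, r+1, r+2)` read in either direction through the
following statement: **`φ_{r+1}φ_rφ_{r+1} e(𝐢)` for `𝐢 = (…, i, j, i, …)` equals
`(s_{r+1}s_rs_{r+1} + s_{r+1}s_r v + s_rs_{r+1} u + s_{r+1} uv + s_r uv + uv² - v² + 1) e(𝐢)`**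
with `u = x_{r,r+1}^{-1}`, `v = x_{r+1,r+2}^{-1}` (realised by `Ring.inverse` of the difference
units) — Brundan–Kleshchev's expansion, p. 8. [folklore] -/
theorem bkPhi_expansion_case4 {r r' r'' : Fin n} (h : (r' : ℕ) = r + 1) (h' : (r'' : ℕ) = r' + 1)
    {χ : Fin n → k} (h13 : χ r = χ r'') (h12 : χ r ≠ χ r') :
    bkIntertwiner k r' r'' * Ring.inverse (bkDiffUnit k r' r'' (χ r - χ r')) *
        (MonoidAlgebra.of k _ (swap r r') + 1) *
        (bkIntertwiner k r' r'' * (Ring.inverse (bkDiffUnit k r' r'' (-(χ r - χ r'))) *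
          klrIdempotent k χ)) =
      (MonoidAlgebra.of k _ (swap r' r'') * MonoidAlgebra.of k _ (swap r r') *
            MonoidAlgebra.of k _ (swap r' r'') +
          MonoidAlgebra.of k _ (swap r' r'') * MonoidAlgebra.of k _ (swap r r') *
            Ring.inverse (bkDiffUnit k r' r'' (-(χ r - χ r'))) +
          MonoidAlgebra.of k _ (swap r r') * MonoidAlgebra.of k _ (swap r' r'') *
            Ring.inverse (bkDiffUnit k r r' (χ r - χ r')) +
          MonoidAlgebra.of k _ (swap r' r'') *
            (Ring.inverse (bkDiffUnit k r r' (χ r - χ r')) *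
              Ring.inverse (bkDiffUnit k r' r'' (-(χ r - χ r')))) +
          MonoidAlgebra.of k _ (swap r r') *
            (Ring.inverse (bkDiffUnit k r r' (χ r - χ r')) *
              Ring.inverse (bkDiffUnit k r' r'' (-(χ r - χ r')))) +
          Ring.inverse (bkDiffUnit k r r' (χ r - χ r')) *
            (Ring.inverse (bkDiffUnit k r' r'' (-(χ r - χ r'))) *
              Ring.inverse (bkDiffUnit k r' r'' (-(χ r - χ r')))) -
          Ring.inverse (bkDiffUnit k r' r'' (-(χ r - χ r'))) *
            Ring.inverse (bkDiffUnit k r' r'' (-(χ r - χ r'))) + 1) *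
        klrIdempotent k χ := by
  have hrr' : r ≠ r' := by intro e; rw [Fin.ext_iff] at e; omega
  have hr'r'' : r' ≠ r'' := by intro e; rw [Fin.ext_iff] at e; omega
  have hrr'' : r ≠ r'' := by intro e; rw [Fin.ext_iff] at e; omega
  have hd : χ r - χ r' ≠ 0 := sub_ne_zero.2 h12
  have hnd : -(χ r - χ r') ≠ 0 := neg_ne_zero.2 hd
  have hu12 := isUnit_bkDiffUnit k r r' hd
  have hu23 := isUnit_bkDiffUnit k r' r'' hnd
  have hu23' := isUnit_bkDiffUnit k r' r'' hd
  have hu13' := isUnit_bkDiffUnit k r r'' hd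
  -- membership of `w₁ = w' θ₂ v e = θ₂ e u v` in `M_{s_{r+1}𝐢}` and of `s_r w₁`
  have cue : Commute (klrIdempotent k χ) (Ring.inverse (bkDiffUnit k r r' (χ r - χ r'))) :=
    commute_ringInverse_of_commute (commute_klrIdempotent_bkDiffUnit k χ r r' _) hu12
  have cve : Commute (klrIdempotent k χ) (Ring.inverse (bkDiffUnit k r' r'' (-(χ r - χ r')))) :=
    commute_ringInverse_of_commute (commute_klrIdempotent_bkDiffUnit k χ r' r'' _) hu23
  have hw'θ : Ring.inverse (bkDiffUnit k r r'' (χ r - χ r')) * bkIntertwiner k r' r'' =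
      bkIntertwiner k r' r'' * Ring.inverse (bkDiffUnit k r r' (χ r - χ r')) := by
    rw [ringInverse_bkDiffUnit_mul_bkIntertwiner k h' r r'' hd, swap_apply_of_ne_of_ne hrr' hrr'',
      swap_apply_right]
  have hw₁ : Ring.inverse (bkDiffUnit k r r'' (χ r - χ r')) * (bkIntertwiner k r' r'' *
      (Ring.inverse (bkDiffUnit k r' r'' (-(χ r - χ r'))) * klrIdempotent k χ)) =
      bkIntertwiner k r' r'' * (klrIdempotent k χ * (Ring.inverse (bkDiffUnit k r r' (χ r - χ r')) *
        Ring.inverse (bkDiffUnit k r' r'' (-(χ r - χ r'))))) := by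
    rw [← mul_assoc, hw'θ, mul_assoc, ← cve.eq, ← mul_assoc (Ring.inverse _) (klrIdempotent k χ),
      ← cue.eq, mul_assoc]
  have hw₁mem : Ring.inverse (bkDiffUnit k r r'' (χ r - χ r')) * (bkIntertwiner k r' r'' *
      (Ring.inverse (bkDiffUnit k r' r'' (-(χ r - χ r'))) * klrIdempotent k χ)) ∈
      jointEigenspace k (χ ∘ swap r' r'') := by
    rw [hw₁]
    exact bkIntertwiner_mul_mem_jointEigenspace k h'
      (mul_mem_jointEigenspace k (klrIdempotent_mem k χ) _)
  have hχ' : (χ ∘ swap r' r'') r = (χ ∘ swap r' r'') r' := by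
    simp [swap_apply_of_ne_of_ne hrr' hrr'', swap_apply_left, h13]
  have haw₁mem := of_swap_mul_mem_of_eq k h hχ' hw₁mem
  -- the hypotheses of the abstract lemma
  have hVa : (jucysMurphy k r' - jucysMurphy k r'') * MonoidAlgebra.of k _ (swap r r') =
      MonoidAlgebra.of k _ (swap r r') * (jucysMurphy k r - jucysMurphy k r'') + 1 := by
    have e1 := jucysMurphy_succ_mul_swap k h
    have e2 := of_swap_mul_jucysMurphy_of_ne k h (Ne.symm hrr'') (Ne.symm hr'r'')
    rw [sub_mul, e1, ← e2, mul_sub]; abel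
  have hWθ : (jucysMurphy k r - jucysMurphy k r'') * bkIntertwiner k r' r'' =
      bkIntertwiner k r' r'' * (jucysMurphy k r - jucysMurphy k r') := by
    rw [mul_sub (bkIntertwiner k r' r''), bkIntertwiner_mul_jucysMurphy_of_ne k h' hrr' hrr'',
      bkIntertwiner_mul_jucysMurphy_left k h', ← sub_mul]
  have hVe : (jucysMurphy k r' - jucysMurphy k r'') * klrIdempotent k χ =
      bkDiffUnit k r' r'' (-(χ r - χ r')) * klrIdempotent k χ := by
    have := jucysMurphy_sub_mul_of_mem k r' r'' (klrIdempotent_mem k χ)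
    rwa [show χ r' - χ r'' = -(χ r - χ r') by rw [h13]; ring] at this
  have hv'θ : Ring.inverse (bkDiffUnit k r' r'' (χ r - χ r')) * bkIntertwiner k r' r'' =
      -(bkIntertwiner k r' r'' * Ring.inverse (bkDiffUnit k r' r'' (-(χ r - χ r')))) := by
    rw [ringInverse_bkDiffUnit_mul_bkIntertwiner k h' r' r'' hd, swap_apply_left, swap_apply_right,
      bkDiffUnit_swap k r' r'' (χ r - χ r'), ringInverse_neg hu23, mul_neg]
  have hVaw₁ := jucysMurphy_sub_mul_of_mem k r' r'' haw₁mem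
  have hsc1 : (χ ∘ swap r' r'') r' - (χ ∘ swap r' r'') r'' = χ r - χ r' := by
    simp [swap_apply_left, swap_apply_right, h13]
  rw [hsc1] at hVaw₁
  have hWw₁ := jucysMurphy_sub_mul_of_mem k r r'' hw₁mem
  have hsc2 : (χ ∘ swap r' r'') r - (χ ∘ swap r' r'') r'' = χ r - χ r' := by
    simp [swap_apply_of_ne_of_ne hrr' hrr'', swap_apply_right]
  rw [hsc2] at hWw₁
  have hL := fun a b : Fin n => commute_jucysMurphy k a b
  have cU12 := (commute_jucysMurphy_bkDiffUnit k r r r' (χ r - χ r')).sub_left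
      (commute_jucysMurphy_bkDiffUnit k r' r r' (χ r - χ r'))
  have cU23 := (commute_jucysMurphy_bkDiffUnit k r r' r'' (-(χ r - χ r'))).sub_left
      (commute_jucysMurphy_bkDiffUnit k r' r' r'' (-(χ r - χ r')))
  have cV12 := (commute_jucysMurphy_bkDiffUnit k r' r r' (χ r - χ r')).sub_left
      (commute_jucysMurphy_bkDiffUnit k r'' r r' (χ r - χ r'))
  have cV23 := (commute_jucysMurphy_bkDiffUnit k r' r' r'' (-(χ r - χ r'))).sub_left
      (commute_jucysMurphy_bkDiffUnit k r'' r' r'' (-(χ r - χ r')))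
  have hθ : bkIntertwiner k r' r'' =
      MonoidAlgebra.of k _ (swap r' r'') * (jucysMurphy k r' - jucysMurphy k r'') + 1 := rfl
  exact bk_braid_case4_aux (a := MonoidAlgebra.of k _ (swap r r'))
    (b := MonoidAlgebra.of k _ (swap r' r'')) (V := jucysMurphy k r' - jucysMurphy k r'')
    (W := jucysMurphy k r - jucysMurphy k r'') (U := jucysMurphy k r - jucysMurphy k r')
    (θ := bkIntertwiner k r' r'') (D12 := bkDiffUnit k r r' (χ r - χ r'))
    (D23 := bkDiffUnit k r' r'' (-(χ r - χ r'))) (D23' := bkDiffUnit k r' r'' (χ r - χ r'))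
    (D13' := bkDiffUnit k r r'' (χ r - χ r'))
    (u := Ring.inverse (bkDiffUnit k r r' (χ r - χ r')))
    (v := Ring.inverse (bkDiffUnit k r' r'' (-(χ r - χ r'))))
    (v' := Ring.inverse (bkDiffUnit k r' r'' (χ r - χ r')))
    (w' := Ring.inverse (bkDiffUnit k r r'' (χ r - χ r'))) (e := klrIdempotent k χ)
    hθ (by rw [bkIntertwiner_mul_self k h', sq]) (of_swap_mul_self k r' r'') hVa hWθ
    (jucysMurphy_sub_mul_of_mem k r r' (klrIdempotent_mem k χ)) hVe
    (Ring.inverse_mul_cancel _ hu12) (Ring.inverse_mul_cancel _ hu23) hw'θ hv'θ hVaw₁ hWw₁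
    (Ring.inverse_mul_cancel _ hu23') (Ring.mul_inverse_cancel _ hu13')
    (commute_ringInverse_of_commute cU12 hu12).eq (commute_ringInverse_of_commute cU23 hu23).eq
    (commute_ringInverse_of_commute cV12 hu12).eq (commute_ringInverse_of_commute cV23 hu23).eq
    ((commute_bkDiffUnit k r r' r' r'' _ _).ringInverse_ringInverse).eq


/-- The mirror image of `bkPhi_expansion_case4` (the same ring lemma with `s_r ↔ s_{r+1}`):
**`φ_rφ_{r+1}φ_r e(𝐢)` for `𝐢 = (…, i, j, i, …)` equals
`(s_rs_{r+1}s_r + s_rs_{r+1} u + s_{r+1}s_r v + s_r vu + s_{r+1} vu + vu² - u² + 1) e(𝐢)`.**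
[folklore] -/
theorem bkPhi_expansion_case4' {r r' r'' : Fin n} (h : (r' : ℕ) = r + 1) (h' : (r'' : ℕ) = r' + 1)
    {χ : Fin n → k} (h13 : χ r = χ r'') (h12 : χ r ≠ χ r') :
    bkIntertwiner k r r' * Ring.inverse (bkDiffUnit k r r' (-(χ r - χ r'))) *
        (MonoidAlgebra.of k _ (swap r' r'') + 1) *
        (bkIntertwiner k r r' * (Ring.inverse (bkDiffUnit k r r' (χ r - χ r')) *
          klrIdempotent k χ)) =
      (MonoidAlgebra.of k _ (swap r r') * MonoidAlgebra.of k _ (swap r' r'') *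
            MonoidAlgebra.of k _ (swap r r') +
          MonoidAlgebra.of k _ (swap r r') * MonoidAlgebra.of k _ (swap r' r'') *
            Ring.inverse (bkDiffUnit k r r' (χ r - χ r')) +
          MonoidAlgebra.of k _ (swap r' r'') * MonoidAlgebra.of k _ (swap r r') *
            Ring.inverse (bkDiffUnit k r' r'' (-(χ r - χ r'))) +
          MonoidAlgebra.of k _ (swap r r') *
            (Ring.inverse (bkDiffUnit k r' r'' (-(χ r - χ r'))) *
              Ring.inverse (bkDiffUnit k r r' (χ r - χ r'))) +
          MonoidAlgebra.of k _ (swap r' r'') *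
            (Ring.inverse (bkDiffUnit k r' r'' (-(χ r - χ r'))) *
              Ring.inverse (bkDiffUnit k r r' (χ r - χ r'))) +
          Ring.inverse (bkDiffUnit k r' r'' (-(χ r - χ r'))) *
            (Ring.inverse (bkDiffUnit k r r' (χ r - χ r')) *
              Ring.inverse (bkDiffUnit k r r' (χ r - χ r'))) -
          Ring.inverse (bkDiffUnit k r r' (χ r - χ r')) *
            Ring.inverse (bkDiffUnit k r r' (χ r - χ r')) + 1) *
        klrIdempotent k χ := by
  have hrr' : r ≠ r' := by intro e; rw [Fin.ext_iff] at e; omega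
  have hr'r'' : r' ≠ r'' := by intro e; rw [Fin.ext_iff] at e; omega
  have hrr'' : r ≠ r'' := by intro e; rw [Fin.ext_iff] at e; omega
  have hd : χ r - χ r' ≠ 0 := sub_ne_zero.2 h12
  have hnd : -(χ r - χ r') ≠ 0 := neg_ne_zero.2 hd
  have hu12 := isUnit_bkDiffUnit k r r' hd
  have hu23 := isUnit_bkDiffUnit k r' r'' hnd
  have hu12' := isUnit_bkDiffUnit k r r' hnd
  have hu13' := isUnit_bkDiffUnit k r r'' hnd
  have cue : Commute (klrIdempotent k χ) (Ring.inverse (bkDiffUnit k r r' (χ r - χ r'))) :=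
    commute_ringInverse_of_commute (commute_klrIdempotent_bkDiffUnit k χ r r' _) hu12
  have cve : Commute (klrIdempotent k χ) (Ring.inverse (bkDiffUnit k r' r'' (-(χ r - χ r')))) :=
    commute_ringInverse_of_commute (commute_klrIdempotent_bkDiffUnit k χ r' r'' _) hu23
  have hw'θ : Ring.inverse (bkDiffUnit k r r'' (-(χ r - χ r'))) * bkIntertwiner k r r' =
      bkIntertwiner k r r' * Ring.inverse (bkDiffUnit k r' r'' (-(χ r - χ r'))) := by
    rw [ringInverse_bkDiffUnit_mul_bkIntertwiner k h r r'' hnd, swap_apply_left,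
      swap_apply_of_ne_of_ne (Ne.symm hrr'') (Ne.symm hr'r'')]
  have hw₁ : Ring.inverse (bkDiffUnit k r r'' (-(χ r - χ r'))) * (bkIntertwiner k r r' *
      (Ring.inverse (bkDiffUnit k r r' (χ r - χ r')) * klrIdempotent k χ)) =
      bkIntertwiner k r r' * (klrIdempotent k χ * (Ring.inverse (bkDiffUnit k r' r'' (-(χ r - χ r'))) *
        Ring.inverse (bkDiffUnit k r r' (χ r - χ r')))) := by
    rw [← mul_assoc, hw'θ, mul_assoc, ← cue.eq, ← mul_assoc (Ring.inverse _) (klrIdempotent k χ),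
      ← cve.eq, mul_assoc]
  have hw₁mem : Ring.inverse (bkDiffUnit k r r'' (-(χ r - χ r'))) * (bkIntertwiner k r r' *
      (Ring.inverse (bkDiffUnit k r r' (χ r - χ r')) * klrIdempotent k χ)) ∈
      jointEigenspace k (χ ∘ swap r r') := by
    rw [hw₁]
    exact bkIntertwiner_mul_mem_jointEigenspace k h
      (mul_mem_jointEigenspace k (klrIdempotent_mem k χ) _)
  have hχ'' : (χ ∘ swap r r') r' = (χ ∘ swap r r') r'' := by
    simp [swap_apply_right, swap_apply_of_ne_of_ne (Ne.symm hrr'') (Ne.symm hr'r''), h13]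
  have hbw₁mem := of_swap_mul_mem_of_eq k h' hχ'' hw₁mem
  have hUb : (jucysMurphy k r - jucysMurphy k r') * MonoidAlgebra.of k _ (swap r' r'') =
      MonoidAlgebra.of k _ (swap r' r'') * (jucysMurphy k r - jucysMurphy k r'') + 1 := by
    have e1 := of_swap_mul_jucysMurphy_of_ne k h' hrr' hrr''
    have e2 := of_swap_mul_jucysMurphy_succ k h'
    have e3 : jucysMurphy k r' * MonoidAlgebra.of k _ (swap r' r'') =
        MonoidAlgebra.of k _ (swap r' r'') * jucysMurphy k r'' - 1 := eq_sub_of_add_eq e2.symm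
    rw [sub_mul, ← e1, mul_sub, e3]; abel
  have hWθ : (jucysMurphy k r - jucysMurphy k r'') * bkIntertwiner k r r' =
      bkIntertwiner k r r' * (jucysMurphy k r' - jucysMurphy k r'') := by
    rw [mul_sub (bkIntertwiner k r r'), bkIntertwiner_mul_jucysMurphy_right k h,
      bkIntertwiner_mul_jucysMurphy_of_ne k h (Ne.symm hrr'') (Ne.symm hr'r''), ← sub_mul]
  have hVe : (jucysMurphy k r' - jucysMurphy k r'') * klrIdempotent k χ =
      bkDiffUnit k r' r'' (-(χ r - χ r')) * klrIdempotent k χ := by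
    have := jucysMurphy_sub_mul_of_mem k r' r'' (klrIdempotent_mem k χ)
    rwa [show χ r' - χ r'' = -(χ r - χ r') by rw [h13]; ring] at this
  have hv'θ : Ring.inverse (bkDiffUnit k r r' (-(χ r - χ r'))) * bkIntertwiner k r r' =
      -(bkIntertwiner k r r' * Ring.inverse (bkDiffUnit k r r' (χ r - χ r'))) := by
    rw [ringInverse_bkDiffUnit_mul_bkIntertwiner k h r r' hnd, swap_apply_left, swap_apply_right,
      bkDiffUnit_swap k r r' (-(χ r - χ r')), neg_neg, ringInverse_neg hu12, mul_neg]
  have hVaw₁ := jucysMurphy_sub_mul_of_mem k r r' hbw₁mem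
  have hsc1 : (χ ∘ swap r r') r - (χ ∘ swap r r') r' = -(χ r - χ r') := by
    simp [swap_apply_left, swap_apply_right]
  rw [hsc1] at hVaw₁
  have hWw₁ := jucysMurphy_sub_mul_of_mem k r r'' hw₁mem
  have hsc2 : (χ ∘ swap r r') r - (χ ∘ swap r r') r'' = -(χ r - χ r') := by
    simp [swap_apply_left, swap_apply_of_ne_of_ne (Ne.symm hrr'') (Ne.symm hr'r''), h13]
  rw [hsc2] at hWw₁
  have cV23 := (commute_jucysMurphy_bkDiffUnit k r' r' r'' (-(χ r - χ r'))).sub_left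
      (commute_jucysMurphy_bkDiffUnit k r'' r' r'' (-(χ r - χ r')))
  have cV12 := (commute_jucysMurphy_bkDiffUnit k r' r r' (χ r - χ r')).sub_left
      (commute_jucysMurphy_bkDiffUnit k r'' r r' (χ r - χ r'))
  have cU23 := (commute_jucysMurphy_bkDiffUnit k r r' r'' (-(χ r - χ r'))).sub_left
      (commute_jucysMurphy_bkDiffUnit k r' r' r'' (-(χ r - χ r')))
  have cU12 := (commute_jucysMurphy_bkDiffUnit k r r r' (χ r - χ r')).sub_left
      (commute_jucysMurphy_bkDiffUnit k r' r r' (χ r - χ r'))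
  have hθ : bkIntertwiner k r r' =
      MonoidAlgebra.of k _ (swap r r') * (jucysMurphy k r - jucysMurphy k r') + 1 := rfl
  exact bk_braid_case4_aux (a := MonoidAlgebra.of k _ (swap r' r''))
    (b := MonoidAlgebra.of k _ (swap r r')) (V := jucysMurphy k r - jucysMurphy k r')
    (W := jucysMurphy k r - jucysMurphy k r'') (U := jucysMurphy k r' - jucysMurphy k r'')
    (θ := bkIntertwiner k r r') (D12 := bkDiffUnit k r' r'' (-(χ r - χ r')))
    (D23 := bkDiffUnit k r r' (χ r - χ r')) (D23' := bkDiffUnit k r r' (-(χ r - χ r')))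
    (D13' := bkDiffUnit k r r'' (-(χ r - χ r')))
    (u := Ring.inverse (bkDiffUnit k r' r'' (-(χ r - χ r'))))
    (v := Ring.inverse (bkDiffUnit k r r' (χ r - χ r')))
    (v' := Ring.inverse (bkDiffUnit k r r' (-(χ r - χ r'))))
    (w' := Ring.inverse (bkDiffUnit k r r'' (-(χ r - χ r')))) (e := klrIdempotent k χ)
    hθ (by rw [bkIntertwiner_mul_self k h, sq]) (of_swap_mul_self k r r') hUb hWθ
    hVe (jucysMurphy_sub_mul_of_mem k r r' (klrIdempotent_mem k χ))
    (Ring.inverse_mul_cancel _ hu23) (Ring.inverse_mul_cancel _ hu12) hw'θ hv'θ hVaw₁ hWw₁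
    (Ring.inverse_mul_cancel _ hu12') (Ring.mul_inverse_cancel _ hu13')
    (commute_ringInverse_of_commute cV23 hu23).eq (commute_ringInverse_of_commute cV12 hu12).eq
    (commute_ringInverse_of_commute cU23 hu23).eq (commute_ringInverse_of_commute cU12 hu12).eq
    ((commute_bkDiffUnit k r' r'' r r' _ _).ringInverse_ringInverse).eq

/-- **(EI6), case `i_r = i_{r+2} ≠ i_{r+1}`:
`φ_rφ_{r+1}φ_r e(𝐢) = (φ_{r+1}φ_rφ_{r+1} + z_r) e(𝐢)` with
`z_r = (x_{r,r+1}^{-1} - x_{r+1,r+2}^{-1})(x_{r,r+1}^{-1}x_{r+1,r+2}^{-1} - x_{r,r+1}^{-1} - x_{r+1,r+2}^{-1})`**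
(Brundan–Kleshchev 2009, Lemma 3.1 (3.12), second case; Case 4 of the proof), the inverses
realised by `Ring.inverse` of the difference units `(i_r - i_{r+1}) + y_r - y_{r+1}`,
`(i_{r+1} - i_{r+2}) + y_{r+1} - y_{r+2}`. [folklore] -/
theorem bkPhi_braid_of_eq_of_ne {r r' r'' : Fin n} (h : (r' : ℕ) = r + 1) (h' : (r'' : ℕ) = r' + 1)
    {χ : Fin n → k} (h13 : χ r = χ r'') (h12 : χ r ≠ χ r') :
    bkPhi k r r' * bkPhi k r' r'' * bkPhi k r r' * klrIdempotent k χ =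
      (bkPhi k r' r'' * bkPhi k r r' * bkPhi k r' r'' +
        (Ring.inverse (bkDiffUnit k r r' (χ r - χ r')) -
            Ring.inverse (bkDiffUnit k r' r'' (χ r' - χ r''))) *
          (Ring.inverse (bkDiffUnit k r r' (χ r - χ r')) *
              Ring.inverse (bkDiffUnit k r' r'' (χ r' - χ r'')) -
            Ring.inverse (bkDiffUnit k r r' (χ r - χ r')) -
            Ring.inverse (bkDiffUnit k r' r'' (χ r' - χ r'')))) * klrIdempotent k χ := by
  have hrr' : r ≠ r' := by intro e; rw [Fin.ext_iff] at e; omega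
  have hr'r'' : r' ≠ r'' := by intro e; rw [Fin.ext_iff] at e; omega
  have hrr'' : r ≠ r'' := by intro e; rw [Fin.ext_iff] at e; omega
  have h23 : χ r' ≠ χ r'' := h13 ▸ (Ne.symm h12)
  have hsc : χ r' - χ r'' = -(χ r - χ r') := by rw [h13]; ring
  -- the six coefficients
  have hA1 : bkPhiCoeff k r r' χ =
      bkIntertwiner k r r' * Ring.inverse (bkDiffUnit k r r' (χ r - χ r')) := by
    rw [bkPhiCoeff, if_neg h12]
  have hA2 : bkPhiCoeff k r' r'' (χ ∘ swap r r') = MonoidAlgebra.of k _ (swap r' r'') + 1 := by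
    have e1 : (χ ∘ swap r r') r' = χ r := by simp [swap_apply_right]
    have e2 : (χ ∘ swap r r') r'' = χ r'' := by
      simp [swap_apply_of_ne_of_ne (Ne.symm hrr'') (Ne.symm hr'r'')]
    rw [bkPhiCoeff, e1, e2, if_pos h13]
  have hA3 : bkPhiCoeff k r r' ((χ ∘ swap r r') ∘ swap r' r'') =
      bkIntertwiner k r r' * Ring.inverse (bkDiffUnit k r r' (-(χ r - χ r'))) := by
    have e1 : ((χ ∘ swap r r') ∘ swap r' r'') r = χ r' := by
      simp [swap_apply_of_ne_of_ne hrr' hrr'', swap_apply_left]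
    have e2 : ((χ ∘ swap r r') ∘ swap r' r'') r' = χ r'' := by
      simp [swap_apply_left, swap_apply_of_ne_of_ne (Ne.symm hrr'') (Ne.symm hr'r'')]
    rw [bkPhiCoeff, e1, e2, if_neg h23, hsc]
  have hB1 : bkPhiCoeff k r' r'' χ =
      bkIntertwiner k r' r'' * Ring.inverse (bkDiffUnit k r' r'' (-(χ r - χ r'))) := by
    rw [bkPhiCoeff, if_neg h23, hsc]
  have hB2 : bkPhiCoeff k r r' (χ ∘ swap r' r'') = MonoidAlgebra.of k _ (swap r r') + 1 := by
    have e1 : (χ ∘ swap r' r'') r = χ r := by simp [swap_apply_of_ne_of_ne hrr' hrr'']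
    have e2 : (χ ∘ swap r' r'') r' = χ r'' := by simp [swap_apply_left]
    rw [bkPhiCoeff, e1, e2, if_pos h13]
  have hB3 : bkPhiCoeff k r' r'' ((χ ∘ swap r' r'') ∘ swap r r') =
      bkIntertwiner k r' r'' * Ring.inverse (bkDiffUnit k r' r'' (χ r - χ r')) := by
    have e1 : ((χ ∘ swap r' r'') ∘ swap r r') r' = χ r := by
      simp [swap_apply_right, swap_apply_of_ne_of_ne hrr' hrr'']
    have e2 : ((χ ∘ swap r' r'') ∘ swap r r') r'' = χ r' := by
      simp [swap_apply_of_ne_of_ne (Ne.symm hrr'') (Ne.symm hr'r''), swap_apply_right]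
    rw [bkPhiCoeff, e1, e2, if_neg h12]
  rw [bkPhi_triple_mul_klrIdempotent_eq k h' h, add_mul, bkPhi_triple_mul_klrIdempotent_eq k h h',
    hA1, hA2, hA3, hB1, hB2, hB3, hsc]
  have E1 := bkPhi_expansion_case4 k h h' h13 h12
  have E2 := bkPhi_expansion_case4' k h h' h13 h12
  have haba : MonoidAlgebra.of k (Perm (Fin n)) (swap r r') * MonoidAlgebra.of k _ (swap r' r'') *
      MonoidAlgebra.of k _ (swap r r') =
      MonoidAlgebra.of k _ (swap r' r'') * MonoidAlgebra.of k _ (swap r r') *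
        MonoidAlgebra.of k _ (swap r' r'') := by
    rw [← map_mul, ← map_mul, ← map_mul, ← map_mul]
    congr 1
    rw [swap_mul_swap_mul_swap hrr' hrr'', swap_comm r r', swap_comm r' r'',
      swap_mul_swap_mul_swap (Ne.symm hr'r'') (Ne.symm hrr''), swap_comm]
  have cuv : Ring.inverse (bkDiffUnit k r r' (χ r - χ r')) *
      Ring.inverse (bkDiffUnit k r' r'' (-(χ r - χ r'))) =
      Ring.inverse (bkDiffUnit k r' r'' (-(χ r - χ r'))) *
        Ring.inverse (bkDiffUnit k r r' (χ r - χ r')) :=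
    ((commute_bkDiffUnit k r r' r' r'' (χ r - χ r') (-(χ r - χ r'))).ringInverse_ringInverse).eq
  have E3 := congrArg (fun x => x * klrIdempotent k χ) (bk_braid_case4_combine haba cuv)
  rw [mul_assoc _ (bkIntertwiner k r r' * _) (klrIdempotent k χ), mul_assoc (bkIntertwiner k r r')
      (Ring.inverse (bkDiffUnit k r r' (χ r - χ r'))) (klrIdempotent k χ), E2,
    mul_assoc _ (bkIntertwiner k r' r'' * _) (klrIdempotent k χ), mul_assoc (bkIntertwiner k r' r'')
      (Ring.inverse (bkDiffUnit k r' r'' (-(χ r - χ r')))) (klrIdempotent k χ), E1, E3]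
  exact add_mul _ _ _

end BKPhiBraidCase4Concrete


/-! ### Brundan–Kleshchev's Khovanov–Lauda generators `ψ_r` (BK §3.3): `p_r(𝐢)`, `q_r(𝐢)`, `ψ_r`

With `y_r` = `bkNilpotent` and the explicit choice (3.30) of the `q_r(𝐢)` (for the quiver of type
`A^{(1)}_{p-1}` on the residues, `i → j ⟺ j = i + 1`), all the power series of BK §3.3 are rational
functions of the `y`'s with UNIT denominators, so they are honest elements of `k[S_n]`
(`Ring.inverse` of units); no power-series calculus is needed. -/

section BKPsi

open Equiv

variable (k : Type*) [Field k] [DecidableEq k] {n : ℕ}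

/-- **`p_r(𝐢)`** (Brundan–Kleshchev (3.22)): `1` if `i_r = i_{r+1}`, else
`(i_r - i_{r+1} + y_r - y_{r+1})^{-1}`. [folklore] -/
def bkP (r r' : Fin n) (χ : Fin n → k) : MonoidAlgebra k (Perm (Fin n)) :=
  if χ r = χ r' then 1 else Ring.inverse (bkDiffUnit k r r' (χ r - χ r'))

/-- **`q_r(𝐢)`, Brundan–Kleshchev's explicit choice (3.30)**, for the quiver `i → j ⟺ j = i + 1`:
`1 + y_{r+1} - y_r` if `i_r = i_{r+1}`; `-p_r(𝐢)` if `i_r ⇄ i_{r+1}`; `p_r(𝐢)² - p_r(𝐢)`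
(`= (1 - p_r(𝐢)²)/(y_{r+1} - y_r)`) if `i_r → i_{r+1}` only; `1` if `i_r ← i_{r+1}` only;
`1 - p_r(𝐢)` if `i_r, i_{r+1}` are distinct and not adjacent. [folklore] -/
def bkQ (r r' : Fin n) (χ : Fin n → k) : MonoidAlgebra k (Perm (Fin n)) :=
  if χ r = χ r' then 1 + (bkNilpotent k r' - bkNilpotent k r)
  else if χ r' = χ r + 1 then
    (if χ r = χ r' + 1 then -bkP k r r' χ else bkP k r r' χ * bkP k r r' χ - bkP k r r' χ)
  else (if χ r = χ r' + 1 then 1 else 1 - bkP k r r' χ)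

/-- **Brundan–Kleshchev's `ψ_r = ∑_𝐢 φ_r q_r(𝐢)^{-1} e(𝐢)`** (BK (3.32)). [folklore] -/
def bkPsi (r r' : Fin n) : MonoidAlgebra k (Perm (Fin n)) :=
  ∑ χ ∈ residueSeqs k n, bkPhi k r r' * Ring.inverse (bkQ k r r' χ) * klrIdempotent k χ

omit [DecidableEq k] in
/-- `bkDiffUnit r r' c - 1 = bkDiffUnit r r' (c - 1)`. [folklore] -/
theorem bkDiffUnit_sub_one (r r' : Fin n) (c : k) [DecidableEq k] :
    bkDiffUnit k r r' c - 1 = bkDiffUnit k r r' (c - 1) := by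
  rw [bkDiffUnit, bkDiffUnit, map_sub, map_one]
  abel

/-- `1 - (c + y_r - y_{r'})^{-1} = (c + y_r - y_{r'})^{-1} ((c - 1) + y_r - y_{r'})` for `c ≠ 0`.
[folklore] -/
theorem one_sub_ringInverse_bkDiffUnit (r r' : Fin n) {c : k} (hc : c ≠ 0) :
    1 - Ring.inverse (bkDiffUnit k r r' c) =
      Ring.inverse (bkDiffUnit k r r' c) * bkDiffUnit k r r' (c - 1) := by
  rw [← bkDiffUnit_sub_one, mul_sub, mul_one, Ring.inverse_mul_cancel _ (isUnit_bkDiffUnit k r r' hc)]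

/-- `1 - p` is a unit when `p = (c + y_r - y_{r'})^{-1}` with `c ∉ {0, 1}`. [folklore] -/
theorem isUnit_one_sub_ringInverse_bkDiffUnit (r r' : Fin n) {c : k} (hc : c ≠ 0) (hc1 : c ≠ 1) :
    IsUnit (1 - Ring.inverse (bkDiffUnit k r r' c)) := by
  rw [one_sub_ringInverse_bkDiffUnit k r r' hc]
  exact (isUnit_bkDiffUnit k r r' hc).ringInverse.mul (isUnit_bkDiffUnit k r r' (sub_ne_zero.2 hc1))

/-- `p_r(𝐢)` is a unit. [folklore] -/
theorem isUnit_bkP (r r' : Fin n) (χ : Fin n → k) : IsUnit (bkP k r r' χ) := by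
  unfold bkP
  split_ifs with h
  · exact isUnit_one
  · exact (isUnit_bkDiffUnit k r r' (sub_ne_zero.2 h)).ringInverse

/-- **`q_r(𝐢)` is a unit** (so `q_r(𝐢)^{-1}` is `Ring.inverse`). [folklore] -/
theorem isUnit_bkQ (r r' : Fin n) (χ : Fin n → k) : IsUnit (bkQ k r r' χ) := by
  unfold bkQ
  split_ifs with h1 h2 h3 h4
  · exact (isNilpotent_bkNilpotent_sub k r' r).isUnit_one_add
  · exact (isUnit_bkP k r r' χ).neg
  · -- `p² - p = -p (1 - p)`, `1 - p` a unit as `i_r - i_{r+1} ≠ 1`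
    have hc : χ r - χ r' ≠ 0 := sub_ne_zero.2 h1
    have hc1 : χ r - χ r' ≠ 1 := fun e => h3 (by rw [← e]; ring)
    have hp : bkP k r r' χ = Ring.inverse (bkDiffUnit k r r' (χ r - χ r')) := by
      rw [bkP, if_neg h1]
    have e : bkP k r r' χ * bkP k r r' χ - bkP k r r' χ = -(bkP k r r' χ * (1 - bkP k r r' χ)) := by
      noncomm_ring
    rw [e, hp]
    exact ((isUnit_bkDiffUnit k r r' hc).ringInverse.mul
      (isUnit_one_sub_ringInverse_bkDiffUnit k r r' hc hc1)).neg
  · exact isUnit_one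
  · have hc : χ r - χ r' ≠ 0 := sub_ne_zero.2 h1
    have hc1 : χ r - χ r' ≠ 1 := fun e => h4 (by rw [← e]; ring)
    rw [bkP, if_neg h1]
    exact isUnit_one_sub_ringInverse_bkDiffUnit k r r' hc hc1

/-- Anything commuting with the `y`'s commutes with `p_r(𝐢)`. [folklore] -/
theorem commute_bkP {z : MonoidAlgebra k (Perm (Fin n))} (hz : ∀ t, Commute z (bkNilpotent k t))
    (r r' : Fin n) (χ : Fin n → k) : Commute z (bkP k r r' χ) := by
  unfold bkP
  split_ifs with h
  · exact Commute.one_right z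
  · exact commute_ringInverse_of_commute
      ((Algebra.commute_algebraMap_right _ z).add_right ((hz r).sub_right (hz r')))
      (isUnit_bkDiffUnit k r r' (sub_ne_zero.2 h))

/-- Anything commuting with the `y`'s commutes with `q_r(𝐢)`. [folklore] -/
theorem commute_bkQ {z : MonoidAlgebra k (Perm (Fin n))} (hz : ∀ t, Commute z (bkNilpotent k t))
    (r r' : Fin n) (χ : Fin n → k) : Commute z (bkQ k r r' χ) := by
  have hp := commute_bkP k hz r r' χ
  unfold bkQ
  split_ifs
  · exact (Commute.one_right z).add_right ((hz r').sub_right (hz r))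
  · exact hp.neg_right
  · exact (hp.mul_right hp).sub_right hp
  · exact Commute.one_right z
  · exact (Commute.one_right z).sub_right hp

/-- … and with `q_r(𝐢)^{-1}`. [folklore] -/
theorem commute_ringInverse_bkQ {z : MonoidAlgebra k (Perm (Fin n))}
    (hz : ∀ t, Commute z (bkNilpotent k t)) (r r' : Fin n) (χ : Fin n → k) :
    Commute z (Ring.inverse (bkQ k r r' χ)) :=
  commute_ringInverse_of_commute (commute_bkQ k hz r r' χ) (isUnit_bkQ k r r' χ)

/-- **`ψ_r e(𝐢) = φ_r q_r(𝐢)^{-1} e(𝐢)`.** [folklore] -/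
theorem bkPsi_mul_klrIdempotent (r r' : Fin n) (χ : Fin n → k) :
    bkPsi k r r' * klrIdempotent k χ = bkPhi k r r' * Ring.inverse (bkQ k r r' χ) * klrIdempotent k χ := by
  by_cases h0 : klrIdempotent k χ = 0
  · rw [h0]; simp
  have hχ : χ ∈ residueSeqs k n := by
    refine mem_residueSeqs_of_ne_bot k fun hbot => h0 ?_
    have hmem := klrIdempotent_mem k χ
    rwa [hbot, Submodule.mem_bot] at hmem
  rw [bkPsi, Finset.sum_mul, Finset.sum_eq_single_of_mem χ hχ]
  · rw [mul_assoc, klrIdempotent_mul_self]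
  · intro χ' _ hne
    rw [mul_assoc, klrIdempotent_mul_klrIdempotent_of_ne k hne, mul_zero]

/-- **(KLR) `ψ_r e(𝐢) = e(s_r𝐢) ψ_r`** (Brundan–Kleshchev Thm 3.2, relation (2.?) `ψ_r e(𝐢) =
e(s_r 𝐢) ψ_r`; from (EI0)). [folklore] -/
theorem bkPsi_mul_klrIdempotent_eq {r r' : Fin n} (h : (r' : ℕ) = r + 1) (χ : Fin n → k) :
    bkPsi k r r' * klrIdempotent k χ = klrIdempotent k (χ ∘ swap r r') * bkPsi k r r' := by
  rw [bkPsi_mul_klrIdempotent, bkPsi, Finset.mul_sum]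
  have hterm : ∀ χ' ∈ residueSeqs k n,
      klrIdempotent k (χ ∘ swap r r') * (bkPhi k r r' * Ring.inverse (bkQ k r r' χ') *
        klrIdempotent k χ') =
      if χ' = χ then bkPhi k r r' * Ring.inverse (bkQ k r r' χ) * klrIdempotent k χ else 0 := by
    intro χ' _
    have hce : Commute (klrIdempotent k χ) (Ring.inverse (bkQ k r r' χ')) :=
      commute_ringInverse_bkQ k (commute_klrIdempotent_bkNilpotent k χ) r r' χ'
    rw [← mul_assoc, ← mul_assoc, ← bkPhi_mul_klrIdempotent_eq k h, mul_assoc _ (klrIdempotent k χ),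
      hce.eq, ← mul_assoc, mul_assoc _ _ (klrIdempotent k χ')]
    by_cases he : χ' = χ
    · subst he; rw [if_pos rfl, klrIdempotent_mul_self]
    · rw [if_neg he, klrIdempotent_mul_klrIdempotent_of_ne k (Ne.symm he), mul_zero]
  rw [Finset.sum_congr rfl hterm, Finset.sum_ite_eq']
  by_cases hmemS : χ ∈ residueSeqs k n
  · rw [if_pos hmemS]
  · rw [if_neg hmemS]
    have h0 : klrIdempotent k χ = 0 := by
      have hbot : jointEigenspace k χ = ⊥ := by
        by_contra hne
        exact hmemS (mem_residueSeqs_of_ne_bot k hne)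
      have hmem := klrIdempotent_mem k χ
      rwa [hbot, Submodule.mem_bot] at hmem
    rw [h0, mul_zero]

/-- **`φ_r e(𝐢) = (s_r + p_r(𝐢)) e(𝐢)`** (Brundan–Kleshchev (3.27)). [folklore] -/
theorem bkPhi_mul_klrIdempotent_eq_swap_add_bkP (r r' : Fin n) (χ : Fin n → k) :
    bkPhi k r r' * klrIdempotent k χ =
      (MonoidAlgebra.of k _ (swap r r') + bkP k r r' χ) * klrIdempotent k χ := by
  rw [bkPhi_mul_klrIdempotent, bkP]
  split_ifs with h
  · rfl
  · have hu := isUnit_bkDiffUnit k r r' (sub_ne_zero.2 h)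
    have hcomm : Commute (jucysMurphy k r - jucysMurphy k r')
        (Ring.inverse (bkDiffUnit k r r' (χ r - χ r'))) :=
      commute_ringInverse_of_commute ((commute_jucysMurphy_bkDiffUnit k r r r' _).sub_left
        (commute_jucysMurphy_bkDiffUnit k r' r r' _)) hu
    rw [bkIntertwiner, add_mul, one_mul, add_mul, mul_assoc (MonoidAlgebra.of k _ (swap r r')),
      hcomm.eq, add_mul, mul_assoc, mul_assoc, jucysMurphy_sub_mul_klrIdempotent, ← bkDiffUnit,
      ← mul_assoc (Ring.inverse _), Ring.inverse_mul_cancel _ hu, one_mul]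

/-- **`φ_r D_t = D_{s_r t} φ_r`** for the diagonal parts `D_t = ∑_𝐢 i_t e(𝐢)`. [folklore] -/
theorem bkPhi_mul_sum_smul_klrIdempotent {r r' : Fin n} (h : (r' : ℕ) = r + 1) (t : Fin n) :
    bkPhi k r r' * (∑ χ ∈ residueSeqs k n, χ t • klrIdempotent k χ) =
      (∑ χ ∈ residueSeqs k n, χ (swap r r' t) • klrIdempotent k χ) * bkPhi k r r' := by
  have hsub : residueSeqs k n ⊆ residueSeqsSwap k r r' := Finset.subset_union_left
  have hlive : ∀ χ, jointEigenspace k χ ≠ ⊥ → χ ∈ residueSeqs k n :=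
    fun _ hχ => mem_residueSeqs_of_ne_bot k hχ
  rw [sum_smul_klrIdempotent_subset k hsub hlive (fun χ => χ t),
    sum_smul_klrIdempotent_subset k hsub hlive (fun χ => χ (swap r r' t)),
    Finset.mul_sum, Finset.sum_mul]
  have hterm : ∀ χ ∈ residueSeqsSwap k r r',
      bkPhi k r r' * (χ t • klrIdempotent k χ) =
        χ t • (klrIdempotent k (χ ∘ swap r r') * bkPhi k r r') := by
    intro χ _
    rw [mul_smul_comm, bkPhi_mul_klrIdempotent_eq k h]
  rw [Finset.sum_congr rfl hterm]
  refine Finset.sum_equiv (compSwapEquiv k r r') (fun χ => ?_) (fun χ _ => ?_)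
  · constructor
    · exact fun hχ => comp_swap_mem_residueSeqsSwap k hχ
    · intro hχ
      have h2 := comp_swap_mem_residueSeqsSwap k hχ
      have e : (χ ∘ swap r r') ∘ swap r r' = χ := by
        funext x
        simp only [Function.comp_apply, swap_apply_self]
      change (χ ∘ swap r r') ∘ swap r r' ∈ _ at h2
      rwa [e] at h2
  · simp only [compSwapEquiv, Equiv.coe_fn_mk, Function.comp_apply, swap_apply_self,
      smul_mul_assoc]

/-- `φ_r y_t = y_t φ_r` for `t ∉ {r, r+1}`. [folklore] -/
theorem bkPhi_mul_bkNilpotent_of_ne {r r' t : Fin n} (h : (r' : ℕ) = r + 1) (htr : t ≠ r)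
    (htr' : t ≠ r') : bkPhi k r r' * bkNilpotent k t = bkNilpotent k t * bkPhi k r r' := by
  have ht : bkNilpotent k t =
      jucysMurphy k t - ∑ χ ∈ residueSeqs k n, χ t • klrIdempotent k χ :=
    eq_sub_of_add_eq (jucysMurphy_eq_bkNilpotent_add k t).symm
  have hD := bkPhi_mul_sum_smul_klrIdempotent k h t
  rw [swap_apply_of_ne_of_ne htr htr'] at hD
  rw [ht, mul_sub, sub_mul, bkPhi_mul_jucysMurphy_of_ne k h htr htr', hD]

/-- **(KLR) `ψ_r y_t = y_t ψ_r` for `t ∉ {r, r+1}`** (Brundan–Kleshchev Thm 3.2; from (EI1)).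
[folklore] -/
theorem bkPsi_mul_bkNilpotent_of_ne {r r' t : Fin n} (h : (r' : ℕ) = r + 1) (htr : t ≠ r)
    (htr' : t ≠ r') : bkPsi k r r' * bkNilpotent k t = bkNilpotent k t * bkPsi k r r' := by
  rw [bkPsi, Finset.sum_mul, Finset.mul_sum]
  refine Finset.sum_congr rfl fun χ _ => ?_
  have h1 := (commute_klrIdempotent_bkNilpotent k χ t).eq
  have h2 := (commute_ringInverse_bkQ k (fun s => (commute_bkNilpotent k t s)) r r' χ).eq
  rw [mul_assoc, h1, ← mul_assoc, mul_assoc (bkPhi k r r'), ← h2, ← mul_assoc,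
    bkPhi_mul_bkNilpotent_of_ne k h htr htr', mul_assoc, mul_assoc, mul_assoc]


/-- **(KLR) `y_{r+1} ψ_r e(𝐢) = (ψ_r y_r + δ_{i_r i_{r+1}}) e(𝐢)`** (Brundan–Kleshchev Thm 3.2,
relation (R5); from (EI4)). [folklore] -/
theorem bkNilpotent_succ_mul_bkPsi_mul_klrIdempotent {r r' : Fin n} (h : (r' : ℕ) = r + 1)
    (χ : Fin n → k) :
    bkNilpotent k r' * bkPsi k r r' * klrIdempotent k χ =
      (bkPsi k r r' * bkNilpotent k r + if χ r = χ r' then 1 else 0) * klrIdempotent k χ := by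
  have f1 : Commute (klrIdempotent k χ) (Ring.inverse (bkQ k r r' χ)) :=
    commute_ringInverse_bkQ k (commute_klrIdempotent_bkNilpotent k χ) r r' χ
  have fy : Commute (bkNilpotent k r) (Ring.inverse (bkQ k r r' χ)) :=
    commute_ringInverse_bkQ k (commute_bkNilpotent k r) r r' χ
  have f2 : bkNilpotent k r' =
      jucysMurphy k r' - ∑ ψ ∈ residueSeqs k n, ψ r' • klrIdempotent k ψ :=
    eq_sub_of_add_eq (jucysMurphy_eq_bkNilpotent_add k r').symm
  have f3 : (∑ ψ ∈ residueSeqs k n, ψ r' • klrIdempotent k ψ) * bkPhi k r r' =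
      bkPhi k r r' * ∑ ψ ∈ residueSeqs k n, ψ r • klrIdempotent k ψ := by
    have := bkPhi_mul_sum_smul_klrIdempotent k h r
    rw [swap_apply_left] at this
    exact this.symm
  have f4 : (∑ ψ ∈ residueSeqs k n, ψ r • klrIdempotent k ψ) * klrIdempotent k χ =
      χ r • klrIdempotent k χ := sum_smul_klrIdempotent_mul_of_mem k r (klrIdempotent_mem k χ)
  have f6 : bkNilpotent k r * klrIdempotent k χ =
      jucysMurphy k r * klrIdempotent k χ - χ r • klrIdempotent k χ := bkNilpotent_mul_klrIdempotent k r χ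
  have hye : bkNilpotent k r * klrIdempotent k χ = klrIdempotent k χ * bkNilpotent k r := by
    rw [bkNilpotent_mul_klrIdempotent, klrIdempotent_mul_bkNilpotent]
  -- LHS = `(L' φ e - c • φ e) q⁻¹`
  have lhs : bkNilpotent k r' * bkPsi k r r' * klrIdempotent k χ =
      (jucysMurphy k r' * bkPhi k r r' * klrIdempotent k χ - χ r • (bkPhi k r r' * klrIdempotent k χ)) *
        Ring.inverse (bkQ k r r' χ) := by
    rw [mul_assoc, bkPsi_mul_klrIdempotent, mul_assoc (bkPhi k r r'), ← f1.eq, ← mul_assoc,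
      ← mul_assoc, f2, sub_mul, sub_mul, mul_assoc _ (bkPhi k r r') (klrIdempotent k χ),
      ← mul_assoc _ (bkPhi k r r'), f3, mul_assoc (bkPhi k r r') _ (klrIdempotent k χ), f4,
      mul_smul_comm]
  -- RHS = `φ (y e) q⁻¹ + δ e`
  have rhs : (bkPsi k r r' * bkNilpotent k r + if χ r = χ r' then 1 else 0) * klrIdempotent k χ =
      bkPhi k r r' * (bkNilpotent k r * klrIdempotent k χ) * Ring.inverse (bkQ k r r' χ) +
        (if χ r = χ r' then 1 else 0) * klrIdempotent k χ := by
    rw [add_mul, mul_assoc (bkPsi k r r'), hye, ← mul_assoc (bkPsi k r r'), bkPsi_mul_klrIdempotent,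
      mul_assoc _ (klrIdempotent k χ), ← hye, mul_assoc (bkPhi k r r') (Ring.inverse _),
      ← mul_assoc (Ring.inverse _), ← fy.eq, mul_assoc (bkNilpotent k r), ← f1.eq,
      ← mul_assoc (bkNilpotent k r), ← mul_assoc (bkPhi k r r')]
  rw [lhs, rhs, jucysMurphy_succ_mul_bkPhi_mul_klrIdempotent k h, f6]
  split_ifs with hc
  · -- `i_r = i_{r+1}`: the extra `(1 - x_{r,r+1}) e = q e`
    have hx : (jucysMurphy k r - jucysMurphy k r') * klrIdempotent k χ =
        (bkNilpotent k r - bkNilpotent k r') * klrIdempotent k χ := by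
      rw [jucysMurphy_sub_mul_klrIdempotent, hc, sub_self, map_zero, zero_add]
    have hq : bkQ k r r' χ = 1 + (bkNilpotent k r' - bkNilpotent k r) := by rw [bkQ, if_pos hc]
    have hqe : (1 - (jucysMurphy k r - jucysMurphy k r')) * klrIdempotent k χ =
        bkQ k r r' χ * klrIdempotent k χ := by
      rw [sub_mul, one_mul, hx, hq]; noncomm_ring
    have hqe' : (1 - (jucysMurphy k r - jucysMurphy k r')) * klrIdempotent k χ *
        Ring.inverse (bkQ k r r' χ) = klrIdempotent k χ := by
      rw [hqe, mul_assoc, f1.eq, ← mul_assoc, Ring.mul_inverse_cancel _ (isUnit_bkQ k r r' χ),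
        one_mul]
    have inner : (bkPhi k r r' * jucysMurphy k r + 1 - (jucysMurphy k r - jucysMurphy k r')) *
          klrIdempotent k χ - χ r • (bkPhi k r r' * klrIdempotent k χ) =
        bkPhi k r r' * (jucysMurphy k r * klrIdempotent k χ - χ r • klrIdempotent k χ) +
          (1 - (jucysMurphy k r - jucysMurphy k r')) * klrIdempotent k χ := by
      simp only [mul_sub, sub_mul, add_mul, one_mul, mul_assoc, mul_smul_comm]
      abel
    rw [one_mul, inner, add_mul, hqe']
  · rw [zero_mul, add_zero, mul_sub, mul_smul_comm,
      mul_assoc (bkPhi k r r') (jucysMurphy k r) (klrIdempotent k χ)]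


/-- **(KLR) `ψ_r y_{r+1} e(𝐢) = (y_r ψ_r + δ_{i_r i_{r+1}}) e(𝐢)`** (Brundan–Kleshchev Thm 3.2,
relation (R6); from (EI3)). [folklore] -/
theorem bkPsi_mul_bkNilpotent_succ_mul_klrIdempotent {r r' : Fin n} (h : (r' : ℕ) = r + 1)
    (χ : Fin n → k) :
    bkPsi k r r' * bkNilpotent k r' * klrIdempotent k χ =
      (bkNilpotent k r * bkPsi k r r' + if χ r = χ r' then 1 else 0) * klrIdempotent k χ := by
  have f1 : Commute (klrIdempotent k χ) (Ring.inverse (bkQ k r r' χ)) :=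
    commute_ringInverse_bkQ k (commute_klrIdempotent_bkNilpotent k χ) r r' χ
  have fy' : Commute (bkNilpotent k r') (Ring.inverse (bkQ k r r' χ)) :=
    commute_ringInverse_bkQ k (commute_bkNilpotent k r') r r' χ
  have f2 : bkNilpotent k r =
      jucysMurphy k r - ∑ ψ ∈ residueSeqs k n, ψ r • klrIdempotent k ψ :=
    eq_sub_of_add_eq (jucysMurphy_eq_bkNilpotent_add k r).symm
  have f3 : (∑ ψ ∈ residueSeqs k n, ψ r • klrIdempotent k ψ) * bkPhi k r r' =
      bkPhi k r r' * ∑ ψ ∈ residueSeqs k n, ψ r' • klrIdempotent k ψ := by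
    have := bkPhi_mul_sum_smul_klrIdempotent k h r'
    rw [swap_apply_right] at this
    exact this.symm
  have f4 : (∑ ψ ∈ residueSeqs k n, ψ r' • klrIdempotent k ψ) * klrIdempotent k χ =
      χ r' • klrIdempotent k χ := sum_smul_klrIdempotent_mul_of_mem k r' (klrIdempotent_mem k χ)
  have hye : bkNilpotent k r' * klrIdempotent k χ = klrIdempotent k χ * bkNilpotent k r' := by
    rw [bkNilpotent_mul_klrIdempotent, klrIdempotent_mul_bkNilpotent]
  -- LHS = `(φ L' e - c' • φ e) q⁻¹`
  have lhs : bkPsi k r r' * bkNilpotent k r' * klrIdempotent k χ =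
      (bkPhi k r r' * jucysMurphy k r' * klrIdempotent k χ - χ r' • (bkPhi k r r' * klrIdempotent k χ)) *
        Ring.inverse (bkQ k r r' χ) := by
    rw [mul_assoc, hye, ← mul_assoc, bkPsi_mul_klrIdempotent, mul_assoc _ (klrIdempotent k χ),
      ← hye, mul_assoc (bkPhi k r r'), ← mul_assoc (Ring.inverse _), ← fy'.eq,
      mul_assoc (bkNilpotent k r'), ← f1.eq, ← mul_assoc (bkNilpotent k r'),
      ← mul_assoc (bkPhi k r r'), bkNilpotent_mul_klrIdempotent, mul_sub, mul_smul_comm,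
      ← mul_assoc (bkPhi k r r') (jucysMurphy k r')]
  -- RHS = `(L φ e - c' • φ e) q⁻¹ + δ e`
  have rhs : (bkNilpotent k r * bkPsi k r r' + if χ r = χ r' then 1 else 0) * klrIdempotent k χ =
      (jucysMurphy k r * bkPhi k r r' * klrIdempotent k χ - χ r' • (bkPhi k r r' * klrIdempotent k χ)) *
        Ring.inverse (bkQ k r r' χ) + (if χ r = χ r' then 1 else 0) * klrIdempotent k χ := by
    rw [add_mul, mul_assoc (bkNilpotent k r), bkPsi_mul_klrIdempotent, mul_assoc (bkPhi k r r'),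
      ← f1.eq, ← mul_assoc (bkPhi k r r') (klrIdempotent k χ) (Ring.inverse _),
      ← mul_assoc (bkNilpotent k r) _ (Ring.inverse _),
      ← mul_assoc (bkNilpotent k r) (bkPhi k r r') (klrIdempotent k χ), f2, sub_mul, sub_mul, f3,
      mul_assoc (bkPhi k r r') _ (klrIdempotent k χ), f4, mul_smul_comm]
  rw [lhs, rhs, bkPhi_mul_jucysMurphy_succ_mul_klrIdempotent k h]
  split_ifs with hc
  · have hx : (jucysMurphy k r - jucysMurphy k r') * klrIdempotent k χ =
        (bkNilpotent k r - bkNilpotent k r') * klrIdempotent k χ := by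
      rw [jucysMurphy_sub_mul_klrIdempotent, hc, sub_self, map_zero, zero_add]
    have hq : bkQ k r r' χ = 1 + (bkNilpotent k r' - bkNilpotent k r) := by rw [bkQ, if_pos hc]
    have hqe : (1 - (jucysMurphy k r - jucysMurphy k r')) * klrIdempotent k χ =
        bkQ k r r' χ * klrIdempotent k χ := by
      rw [sub_mul, one_mul, hx, hq]; noncomm_ring
    have hqe' : (1 - (jucysMurphy k r - jucysMurphy k r')) * klrIdempotent k χ *
        Ring.inverse (bkQ k r r' χ) = klrIdempotent k χ := by
      rw [hqe, mul_assoc, f1.eq, ← mul_assoc, Ring.mul_inverse_cancel _ (isUnit_bkQ k r r' χ),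
        one_mul]
    have inner : (jucysMurphy k r * bkPhi k r r' + 1 - (jucysMurphy k r - jucysMurphy k r')) *
          klrIdempotent k χ - χ r' • (bkPhi k r r' * klrIdempotent k χ) =
        (jucysMurphy k r * bkPhi k r r' * klrIdempotent k χ - χ r' • (bkPhi k r r' * klrIdempotent k χ)) +
          (1 - (jucysMurphy k r - jucysMurphy k r')) * klrIdempotent k χ := by
      simp only [sub_mul, add_mul, one_mul, mul_assoc]
      abel
    rw [one_mul, inner, add_mul, hqe']
  · rw [zero_mul, add_zero]


omit [DecidableEq k] in
/-- `q_r(s_t 𝐢) = q_r(𝐢)` for `t, t' ∉ {r, r+1}` (it only depends on `i_r, i_{r+1}`). [folklore] -/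
theorem bkQ_comp_swap [DecidableEq k] {r r' t t' : Fin n} (h1 : t ≠ r) (h2 : t ≠ r') (h3 : t' ≠ r)
    (h4 : t' ≠ r') (χ : Fin n → k) : bkQ k r r' (χ ∘ swap t t') = bkQ k r r' χ := by
  simp only [bkQ, bkP, Function.comp_apply, swap_apply_of_ne_of_ne h1.symm h3.symm,
    swap_apply_of_ne_of_ne h2.symm h4.symm]

/-- `φ_t` commutes with `q_r(𝐢)^{-1}` for `|r - t| > 1`. [folklore] -/
theorem commute_bkPhi_ringInverse_bkQ {r r' t t' : Fin n} (ht : (t' : ℕ) = t + 1) (h1 : t ≠ r)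
    (h2 : t ≠ r') (h3 : t' ≠ r) (h4 : t' ≠ r') (χ : Fin n → k) :
    Commute (bkPhi k t t') (Ring.inverse (bkQ k r r' χ)) := by
  -- `q_r(𝐢)` is built from `y_r`, `y_{r'}` only, with which `φ_t` commutes
  have hr : Commute (bkPhi k t t') (bkNilpotent k r) :=
    bkPhi_mul_bkNilpotent_of_ne k ht h1.symm h3.symm
  have hr' : Commute (bkPhi k t t') (bkNilpotent k r') :=
    bkPhi_mul_bkNilpotent_of_ne k ht h2.symm h4.symm
  have hp : Commute (bkPhi k t t') (bkP k r r' χ) := by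
    unfold bkP
    split_ifs with h
    · exact Commute.one_right _
    · exact commute_ringInverse_of_commute
        ((Algebra.commute_algebraMap_right _ _).add_right (hr.sub_right hr'))
        (isUnit_bkDiffUnit k r r' (sub_ne_zero.2 h))
  have hq : Commute (bkPhi k t t') (bkQ k r r' χ) := by
    unfold bkQ
    split_ifs
    · exact (Commute.one_right _).add_right (hr'.sub_right hr)
    · exact hp.neg_right
    · exact (hp.mul_right hp).sub_right hp
    · exact Commute.one_right _
    · exact (Commute.one_right _).sub_right hp
  exact commute_ringInverse_of_commute hq (isUnit_bkQ k r r' χ)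

/-- **(KLR) `ψ_r ψ_t = ψ_t ψ_r` for `|r - t| > 1`** (Brundan–Kleshchev Thm 3.2; from (EI2)).
[folklore] -/
theorem bkPsi_comm_of_far {r r' t t' : Fin n} (hr : (r' : ℕ) = r + 1) (ht : (t' : ℕ) = t + 1)
    (h1 : t ≠ r) (h2 : t ≠ r') (h3 : t' ≠ r) (h4 : t' ≠ r') :
    bkPsi k r r' * bkPsi k t t' = bkPsi k t t' * bkPsi k r r' := by
  -- `e`-wise: `ψ_r ψ_t e(𝐢) = φ_r φ_t q_r(𝐢)^{-1} q_t(𝐢)^{-1} e(𝐢)`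
  have key : ∀ {a a' b b' : Fin n}, ((a' : ℕ) = a + 1) → ((b' : ℕ) = b + 1) → b ≠ a → b ≠ a' →
      b' ≠ a → b' ≠ a' → ∀ χ : Fin n → k,
      bkPsi k a a' * bkPsi k b b' * klrIdempotent k χ =
        bkPhi k a a' * bkPhi k b b' * (Ring.inverse (bkQ k a a' χ) * Ring.inverse (bkQ k b b' χ)) *
          klrIdempotent k χ := by
    intro a a' b b' ha hb h1 h2 h3 h4 χ
    have hce : Commute (klrIdempotent k (χ ∘ swap b b')) (Ring.inverse (bkQ k a a' χ)) :=
      commute_ringInverse_bkQ k (commute_klrIdempotent_bkNilpotent k _) a a' χ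
    have hφq : Commute (bkPhi k b b') (Ring.inverse (bkQ k a a' χ)) :=
      commute_bkPhi_ringInverse_bkQ k hb h1 h2 h3 h4 χ
    rw [mul_assoc, bkPsi_mul_klrIdempotent_eq k hb, ← mul_assoc, bkPsi_mul_klrIdempotent,
      bkQ_comp_swap k h1 h2 h3 h4, mul_assoc _ (klrIdempotent k (χ ∘ swap b b')), ← bkPsi_mul_klrIdempotent_eq k hb,
      bkPsi_mul_klrIdempotent, mul_assoc (bkPhi k a a'), ← mul_assoc (Ring.inverse (bkQ k a a' χ)),
      ← mul_assoc (Ring.inverse (bkQ k a a' χ)), ← hφq.eq]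
    noncomm_ring
  rw [← mul_one (bkPsi k r r' * bkPsi k t t'), ← mul_one (bkPsi k t t' * bkPsi k r r'),
    ← sum_residueSeqs_klrIdempotent k (n := n), Finset.mul_sum, Finset.mul_sum]
  refine Finset.sum_congr rfl fun χ _ => ?_
  have hqq : Commute (Ring.inverse (bkQ k r r' χ)) (Ring.inverse (bkQ k t t' χ)) :=
    (commute_bkQ k (fun s => (commute_bkQ k (commute_bkNilpotent k s) r r' χ).symm)
      t t' χ).ringInverse_ringInverse
  rw [key hr ht h1 h2 h3 h4, key ht hr h1.symm h3.symm h2.symm h4.symm,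
    bkPhi_comm_of_far k hr ht h1 h2 h3 h4, hqq.eq]

end BKPsi


/-! ### Towards (R4) `ψ_r² e(𝐢) = Q_{i_r i_{r+1}}(y_r, y_{r+1}) e(𝐢)`: `φ_r` exchanges `y_r`, `y_{r+1}` on `M_𝐢`
for `i_r ≠ i_{r+1}`, and `ψ_r² e(𝐢) = 0` for `i_r = i_{r+1}` -/

section BKPsiSquare

open Equiv

variable (k : Type*) [Field k] [DecidableEq k] {n : ℕ}

omit [DecidableEq k] in
/-- Left multiplication by an element commuting with the `L_t` preserves `M_𝐢`. [folklore] -/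
theorem mul_left_mem_jointEigenspace_of_comm {χ : Fin n → k} {z v : MonoidAlgebra k (Perm (Fin n))}
    (hz : ∀ t, jucysMurphy k t * z = z * jucysMurphy k t) (hv : v ∈ jointEigenspace k χ) :
    z * v ∈ jointEigenspace k χ := by
  simp only [jointEigenspace, Submodule.mem_iInf] at hv ⊢
  intro t
  exact Module.End.mapsTo_maxGenEigenspace_of_comm (commute_mulLeft_of_mul_eq k (hz t)) (χ t) (hv t)

/-- `φ_r w ∈ M_{s_r𝐢}` for `w ∈ M_𝐢`. [folklore] -/
theorem bkPhi_mul_mem {r r' : Fin n} (h : (r' : ℕ) = r + 1) {χ : Fin n → k}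
    {w : MonoidAlgebra k (Perm (Fin n))} (hw : w ∈ jointEigenspace k χ) :
    bkPhi k r r' * w ∈ jointEigenspace k (χ ∘ swap r r') := by
  rw [← klrIdempotent_mul_of_mem k hw, ← mul_assoc, bkPhi_mul_klrIdempotent_eq k h, mul_assoc]
  exact mul_mem_jointEigenspace k (klrIdempotent_mem k _) _

/-- **`φ_r y_{r+1} w = y_r φ_r w` for `w ∈ M_𝐢`, `i_r ≠ i_{r+1}`** (from (EI3)). [folklore] -/
theorem bkPhi_mul_bkNilpotent_succ_mul_of_mem {r r' : Fin n} (h : (r' : ℕ) = r + 1)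
    {χ : Fin n → k} (hc : χ r ≠ χ r') {w : MonoidAlgebra k (Perm (Fin n))}
    (hw : w ∈ jointEigenspace k χ) :
    bkPhi k r r' * (bkNilpotent k r' * w) = bkNilpotent k r * (bkPhi k r r' * w) := by
  -- the `e(𝐢)`-version
  have he : bkPhi k r r' * (bkNilpotent k r' * klrIdempotent k χ) =
      bkNilpotent k r * (bkPhi k r r' * klrIdempotent k χ) := by
    have hL := bkPhi_mul_jucysMurphy_succ_mul_klrIdempotent k h χ
    rw [if_neg hc] at hL
    have hy' : bkNilpotent k r' =
        jucysMurphy k r' - ∑ ψ ∈ residueSeqs k n, ψ r' • klrIdempotent k ψ :=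
      eq_sub_of_add_eq (jucysMurphy_eq_bkNilpotent_add k r').symm
    have hy : bkNilpotent k r =
        jucysMurphy k r - ∑ ψ ∈ residueSeqs k n, ψ r • klrIdempotent k ψ :=
      eq_sub_of_add_eq (jucysMurphy_eq_bkNilpotent_add k r).symm
    have hD' : (∑ ψ ∈ residueSeqs k n, ψ r' • klrIdempotent k ψ) * klrIdempotent k χ =
        χ r' • klrIdempotent k χ := sum_smul_klrIdempotent_mul_of_mem k r' (klrIdempotent_mem k χ)
    have hφe : bkPhi k r r' * klrIdempotent k χ ∈ jointEigenspace k (χ ∘ swap r r') :=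
      bkPhi_mul_mem k h (klrIdempotent_mem k χ)
    have hD : (∑ ψ ∈ residueSeqs k n, ψ r • klrIdempotent k ψ) * (bkPhi k r r' * klrIdempotent k χ) =
        χ r' • (bkPhi k r r' * klrIdempotent k χ) := by
      have := sum_smul_klrIdempotent_mul_of_mem k r hφe
      simpa [swap_apply_left] using this
    rw [hy', sub_mul, mul_sub, hD', mul_smul_comm, ← mul_assoc, hL, hy, sub_mul, hD, mul_assoc]
  rw [← klrIdempotent_mul_of_mem k hw, ← mul_assoc (bkNilpotent k r'), ← mul_assoc (bkPhi k r r'),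
    he, mul_assoc, mul_assoc]

/-- **`φ_r y_r w = y_{r+1} φ_r w` for `w ∈ M_𝐢`, `i_r ≠ i_{r+1}`** (from (EI4)). [folklore] -/
theorem bkPhi_mul_bkNilpotent_mul_of_mem {r r' : Fin n} (h : (r' : ℕ) = r + 1)
    {χ : Fin n → k} (hc : χ r ≠ χ r') {w : MonoidAlgebra k (Perm (Fin n))}
    (hw : w ∈ jointEigenspace k χ) :
    bkPhi k r r' * (bkNilpotent k r * w) = bkNilpotent k r' * (bkPhi k r r' * w) := by
  have he : bkPhi k r r' * (bkNilpotent k r * klrIdempotent k χ) =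
      bkNilpotent k r' * (bkPhi k r r' * klrIdempotent k χ) := by
    have hL := jucysMurphy_succ_mul_bkPhi_mul_klrIdempotent k h χ
    rw [if_neg hc] at hL
    have hy' : bkNilpotent k r' =
        jucysMurphy k r' - ∑ ψ ∈ residueSeqs k n, ψ r' • klrIdempotent k ψ :=
      eq_sub_of_add_eq (jucysMurphy_eq_bkNilpotent_add k r').symm
    have hy : bkNilpotent k r =
        jucysMurphy k r - ∑ ψ ∈ residueSeqs k n, ψ r • klrIdempotent k ψ :=
      eq_sub_of_add_eq (jucysMurphy_eq_bkNilpotent_add k r).symm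
    have hD : (∑ ψ ∈ residueSeqs k n, ψ r • klrIdempotent k ψ) * klrIdempotent k χ =
        χ r • klrIdempotent k χ := sum_smul_klrIdempotent_mul_of_mem k r (klrIdempotent_mem k χ)
    have hφe : bkPhi k r r' * klrIdempotent k χ ∈ jointEigenspace k (χ ∘ swap r r') :=
      bkPhi_mul_mem k h (klrIdempotent_mem k χ)
    have hD' : (∑ ψ ∈ residueSeqs k n, ψ r' • klrIdempotent k ψ) * (bkPhi k r r' * klrIdempotent k χ) =
        χ r • (bkPhi k r r' * klrIdempotent k χ) := by
      have := sum_smul_klrIdempotent_mul_of_mem k r' hφe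
      simpa [swap_apply_right] using this
    rw [hy, sub_mul, mul_sub, hD, mul_smul_comm, ← mul_assoc, ← hL, hy', sub_mul, hD', mul_assoc]
  rw [← klrIdempotent_mul_of_mem k hw, ← mul_assoc (bkNilpotent k r), ← mul_assoc (bkPhi k r r'),
    he, mul_assoc, mul_assoc]

/-- **`φ_r (c + y_r - y_{r+1}) w = (c + y_{r+1} - y_r) φ_r w` on `M_𝐢`, `i_r ≠ i_{r+1}`.** [folklore] -/
theorem bkPhi_mul_bkDiffUnit_mul_of_mem {r r' : Fin n} (h : (r' : ℕ) = r + 1)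
    {χ : Fin n → k} (hc : χ r ≠ χ r') {w : MonoidAlgebra k (Perm (Fin n))}
    (hw : w ∈ jointEigenspace k χ) (c : k) :
    bkPhi k r r' * (bkDiffUnit k r r' c * w) = bkDiffUnit k r' r c * (bkPhi k r r' * w) := by
  rw [bkDiffUnit, bkDiffUnit, add_mul (algebraMap k _ c) (bkNilpotent k r - bkNilpotent k r') w,
    sub_mul (bkNilpotent k r) (bkNilpotent k r') w, mul_add (bkPhi k r r'), mul_sub (bkPhi k r r'),
    ← mul_assoc (bkPhi k r r') (algebraMap k _ c) w,
    ← (Algebra.commute_algebraMap_left c (bkPhi k r r')).eq, mul_assoc (algebraMap k _ c),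
    bkPhi_mul_bkNilpotent_mul_of_mem k h hc hw, bkPhi_mul_bkNilpotent_succ_mul_of_mem k h hc hw,
    add_mul (algebraMap k _ c), sub_mul (bkNilpotent k r') (bkNilpotent k r)]


/-- **`φ_r (c + y_r - y_{r+1})^{-1} w = (c + y_{r+1} - y_r)^{-1} φ_r w` on `M_𝐢`, `i_r ≠ i_{r+1}`,
`c ≠ 0`.** [folklore] -/
theorem bkPhi_mul_ringInverse_bkDiffUnit_mul_of_mem {r r' : Fin n} (h : (r' : ℕ) = r + 1)
    {χ : Fin n → k} (hc : χ r ≠ χ r') {w : MonoidAlgebra k (Perm (Fin n))}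
    (hw : w ∈ jointEigenspace k χ) {c : k} (hc0 : c ≠ 0) :
    bkPhi k r r' * (Ring.inverse (bkDiffUnit k r r' c) * w) =
      Ring.inverse (bkDiffUnit k r' r c) * (bkPhi k r r' * w) := by
  have hu := isUnit_bkDiffUnit k r r' hc0
  have hu' := isUnit_bkDiffUnit k r' r hc0
  have hw₁ : Ring.inverse (bkDiffUnit k r r' c) * w ∈ jointEigenspace k χ :=
    mul_left_mem_jointEigenspace_of_comm k
      (fun t => (commute_ringInverse_of_commute (commute_jucysMurphy_bkDiffUnit k t r r' c) hu).eq) hw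
  have key := bkPhi_mul_bkDiffUnit_mul_of_mem k h hc hw₁ c
  rw [← mul_assoc (bkDiffUnit k r r' c), Ring.mul_inverse_cancel _ hu, one_mul] at key
  rw [key, ← mul_assoc (Ring.inverse (bkDiffUnit k r' r c)) (bkDiffUnit k r' r c),
    Ring.inverse_mul_cancel _ hu', one_mul]

/-- **`ψ_r² e(𝐢) = φ_r q_r(s_r𝐢)^{-1} φ_r q_r(𝐢)^{-1} e(𝐢)`** (Brundan–Kleshchev, (3.35)).
[folklore] -/
theorem bkPsi_mul_bkPsi_mul_klrIdempotent {r r' : Fin n} (h : (r' : ℕ) = r + 1) (χ : Fin n → k) :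
    bkPsi k r r' * bkPsi k r r' * klrIdempotent k χ =
      bkPhi k r r' * Ring.inverse (bkQ k r r' (χ ∘ swap r r')) *
        (bkPhi k r r' * Ring.inverse (bkQ k r r' χ) * klrIdempotent k χ) := by
  have h1 : bkPsi k r r' * klrIdempotent k χ =
      klrIdempotent k (χ ∘ swap r r') * (bkPsi k r r' * klrIdempotent k χ) := by
    rw [← mul_assoc, ← bkPsi_mul_klrIdempotent_eq k h, mul_assoc, klrIdempotent_mul_self]
  rw [mul_assoc, h1, ← mul_assoc (bkPsi k r r'), bkPsi_mul_klrIdempotent, mul_assoc _ _ (bkPsi k r r' * _),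
    ← h1, bkPsi_mul_klrIdempotent]

/-- **(R4), `i_r = i_{r+1}`: `ψ_r² e(𝐢) = 0`** (Brundan–Kleshchev Thm 3.2; from
`(s_r+1)(1+x_{r,r+1}) = (1-x_{r,r+1})(s_r-1)` and `s_r² = 1`). [folklore] -/
theorem bkPsi_mul_bkPsi_mul_klrIdempotent_of_eq {r r' : Fin n} (h : (r' : ℕ) = r + 1)
    {χ : Fin n → k} (hc : χ r = χ r') :
    bkPsi k r r' * bkPsi k r r' * klrIdempotent k χ = 0 := by
  have hrr' : r ≠ r' := by intro e; rw [Fin.ext_iff] at e; omega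
  have hfix : χ ∘ swap r r' = χ := by
    funext x
    simp only [Function.comp_apply]
    by_cases h1 : x = r
    · subst h1; rw [swap_apply_left, hc]
    by_cases h2 : x = r'
    · subst h2; rw [swap_apply_right, hc]
    rw [swap_apply_of_ne_of_ne h1 h2]
  -- notation-free names for the units `Q = 1 + (y' - y)`, `R = 1 + (y - y')`
  have hq : bkQ k r r' χ = 1 + (bkNilpotent k r' - bkNilpotent k r) := by rw [bkQ, if_pos hc]
  have hQ : IsUnit (bkQ k r r' χ) := isUnit_bkQ k r r' χ
  have hR : IsUnit (1 + (bkNilpotent k r - bkNilpotent k r')) :=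
    (isNilpotent_bkNilpotent_sub k r r').isUnit_one_add
  -- commutations with the `L_t` (for membership) and with `e`
  have hQL : ∀ t, jucysMurphy k t * Ring.inverse (bkQ k r r' χ) =
      Ring.inverse (bkQ k r r' χ) * jucysMurphy k t :=
    fun t => (commute_ringInverse_bkQ k (commute_jucysMurphy_bkNilpotent k t) r r' χ).eq
  have hRL : ∀ t, jucysMurphy k t * Ring.inverse (1 + (bkNilpotent k r - bkNilpotent k r')) =
      Ring.inverse (1 + (bkNilpotent k r - bkNilpotent k r')) * jucysMurphy k t :=
    fun t => (commute_ringInverse_of_commute ((Commute.one_right _).add_right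
      ((commute_jucysMurphy_bkNilpotent k t r).sub_right (commute_jucysMurphy_bkNilpotent k t r')))
      hR).eq
  have hQe : Commute (klrIdempotent k χ) (Ring.inverse (bkQ k r r' χ)) :=
    commute_ringInverse_bkQ k (commute_klrIdempotent_bkNilpotent k χ) r r' χ
  -- `φ w = (s + 1) w` on `M_𝐢`
  have hφ : ∀ {w}, w ∈ jointEigenspace k χ →
      bkPhi k r r' * w = (MonoidAlgebra.of k _ (swap r r') + 1) * w := by
    intro w hw
    rw [← klrIdempotent_mul_of_mem k hw, ← mul_assoc, bkPhi_mul_klrIdempotent, if_pos hc, mul_assoc]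
  -- `(s+1)(1+x) = (1-x)(s-1)` in `k[S_n]`
  have hsx : MonoidAlgebra.of k _ (swap r r') * (jucysMurphy k r - jucysMurphy k r') =
      -((jucysMurphy k r - jucysMurphy k r') * MonoidAlgebra.of k _ (swap r r')) - 1 - 1 := by
    have e1 := of_swap_mul_jucysMurphy_succ k h
    have e2 := jucysMurphy_succ_mul_swap k h
    have e3 : MonoidAlgebra.of k _ (swap r r') * jucysMurphy k r =
        jucysMurphy k r' * MonoidAlgebra.of k _ (swap r r') - 1 := eq_sub_of_add_eq e2.symm
    rw [mul_sub, e3, e1, sub_mul]; abel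
  have hid : (MonoidAlgebra.of k _ (swap r r') + 1) * (1 + (jucysMurphy k r - jucysMurphy k r')) =
      (1 - (jucysMurphy k r - jucysMurphy k r')) * (MonoidAlgebra.of k _ (swap r r') - 1) := by
    calc (MonoidAlgebra.of k _ (swap r r') + 1) * (1 + (jucysMurphy k r - jucysMurphy k r'))
        = MonoidAlgebra.of k _ (swap r r') +
            MonoidAlgebra.of k _ (swap r r') * (jucysMurphy k r - jucysMurphy k r') + 1 +
            (jucysMurphy k r - jucysMurphy k r') := by noncomm_ring
      _ = _ := by rw [hsx]; noncomm_ring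
  -- on `M_𝐢`: `(1 + x) w = R w`, `(1 - x) w = Q w`
  have hx : ∀ {w}, w ∈ jointEigenspace k χ →
      (jucysMurphy k r - jucysMurphy k r') * w = (bkNilpotent k r - bkNilpotent k r') * w := by
    intro w hw
    rw [jucysMurphy_sub_mul_of_mem k r r' hw, hc, sub_self, bkDiffUnit, map_zero, zero_add]
  have hRw : ∀ {w}, w ∈ jointEigenspace k χ →
      (1 + (jucysMurphy k r - jucysMurphy k r')) * w = (1 + (bkNilpotent k r - bkNilpotent k r')) * w := by
    intro w hw; rw [add_mul, add_mul, hx hw]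
  have hQw : ∀ {w}, w ∈ jointEigenspace k χ →
      (1 - (jucysMurphy k r - jucysMurphy k r')) * w = bkQ k r r' χ * w := by
    intro w hw; rw [sub_mul, hx hw, hq]; noncomm_ring
  -- the element `w₂ = R⁻¹ Q⁻¹ e ∈ M_𝐢`
  have hQe_mem : Ring.inverse (bkQ k r r' χ) * klrIdempotent k χ ∈ jointEigenspace k χ :=
    mul_left_mem_jointEigenspace_of_comm k hQL (klrIdempotent_mem k χ)
  have hw₂ : Ring.inverse (1 + (bkNilpotent k r - bkNilpotent k r')) *
      (Ring.inverse (bkQ k r r' χ) * klrIdempotent k χ) ∈ jointEigenspace k χ :=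
    mul_left_mem_jointEigenspace_of_comm k hRL hQe_mem
  have hsw₂ := of_swap_mul_mem_of_eq k h hc hw₂
  -- `(s+1) Q⁻¹ e = Q (s-1) w₂`
  have step : (MonoidAlgebra.of k _ (swap r r') + 1) * (Ring.inverse (bkQ k r r' χ) * klrIdempotent k χ) =
      bkQ k r r' χ * ((MonoidAlgebra.of k _ (swap r r') - 1) *
        (Ring.inverse (1 + (bkNilpotent k r - bkNilpotent k r')) *
          (Ring.inverse (bkQ k r r' χ) * klrIdempotent k χ))) := by
    have := congrArg (· * (Ring.inverse (1 + (bkNilpotent k r - bkNilpotent k r')) *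
      (Ring.inverse (bkQ k r r' χ) * klrIdempotent k χ))) hid
    simp only [mul_assoc] at this
    rw [hRw hw₂, ← mul_assoc (1 + (bkNilpotent k r - bkNilpotent k r')),
      Ring.mul_inverse_cancel _ hR, one_mul] at this
    have hmem' : (MonoidAlgebra.of k _ (swap r r') - 1) *
        (Ring.inverse (1 + (bkNilpotent k r - bkNilpotent k r')) *
          (Ring.inverse (bkQ k r r' χ) * klrIdempotent k χ)) ∈ jointEigenspace k χ := by
      simpa [sub_mul] using Submodule.sub_mem _ hsw₂ hw₂
    rw [this, hQw hmem']
  -- assemble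
  have hinner : bkPhi k r r' * Ring.inverse (bkQ k r r' χ) * klrIdempotent k χ =
      (MonoidAlgebra.of k _ (swap r r') + 1) * (Ring.inverse (bkQ k r r' χ) * klrIdempotent k χ) := by
    rw [mul_assoc, hφ hQe_mem]
  have hmem3 : Ring.inverse (bkQ k r r' χ) * ((MonoidAlgebra.of k _ (swap r r') + 1) *
      (Ring.inverse (bkQ k r r' χ) * klrIdempotent k χ)) ∈ jointEigenspace k χ :=
    mul_left_mem_jointEigenspace_of_comm k hQL
      (by simpa [add_mul] using Submodule.add_mem _ (of_swap_mul_mem_of_eq k h hc hQe_mem) hQe_mem)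
  rw [bkPsi_mul_bkPsi_mul_klrIdempotent k h, hfix, hinner, mul_assoc (bkPhi k r r'), hφ hmem3, step,
    ← mul_assoc (Ring.inverse (bkQ k r r' χ)), Ring.inverse_mul_cancel _ hQ, one_mul, ← mul_assoc,
    show (MonoidAlgebra.of k (Perm (Fin n)) (swap r r') + 1) * (MonoidAlgebra.of k _ (swap r r') - 1) = 0 by
      rw [show (MonoidAlgebra.of k (Perm (Fin n)) (swap r r') + 1) * (MonoidAlgebra.of k _ (swap r r') - 1) =
          MonoidAlgebra.of k _ (swap r r') * MonoidAlgebra.of k _ (swap r r') - 1 by noncomm_ring,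
        of_swap_mul_self, sub_self],
    zero_mul]


/-- **`φ_r p_r(𝐢) w = -p_r(s_r𝐢) φ_r w` on `M_𝐢` for `i_r ≠ i_{r+1}`** (`{}^{s_r}p_r(s_r𝐢) = -p_r(𝐢)`,
Brundan–Kleshchev (3.23)). [folklore] -/
theorem bkPhi_mul_bkP_mul_of_mem {r r' : Fin n} (h : (r' : ℕ) = r + 1) {χ : Fin n → k}
    (hc : χ r ≠ χ r') {w : MonoidAlgebra k (Perm (Fin n))} (hw : w ∈ jointEigenspace k χ) :
    bkPhi k r r' * (bkP k r r' χ * w) = -(bkP k r r' (χ ∘ swap r r') * (bkPhi k r r' * w)) := by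
  have e1 : (χ ∘ swap r r') r = χ r' := by simp [swap_apply_left]
  have e2 : (χ ∘ swap r r') r' = χ r := by simp [swap_apply_right]
  rw [bkP, if_neg hc, bkP, e1, e2, if_neg (Ne.symm hc),
    bkPhi_mul_ringInverse_bkDiffUnit_mul_of_mem k h hc hw (sub_ne_zero.2 hc), bkDiffUnit_swap k r r',
    ringInverse_neg (isUnit_bkDiffUnit k r r' (neg_ne_zero.2 (sub_ne_zero.2 hc))), neg_sub, neg_mul]

/-- `p_r(𝐢) w ∈ M_𝐢`. [folklore] -/
theorem bkP_mul_mem (r r' : Fin n) {χ : Fin n → k} (ψ : Fin n → k)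
    {w : MonoidAlgebra k (Perm (Fin n))} (hw : w ∈ jointEigenspace k χ) :
    bkP k r r' ψ * w ∈ jointEigenspace k χ :=
  mul_left_mem_jointEigenspace_of_comm k
    (fun t => (commute_bkP k (commute_jucysMurphy_bkNilpotent k t) r r' ψ).eq) hw

/-- **`{}^{s_r}q_r(s_r𝐢)`** for the explicit `q` and `i_r ≠ i_{r+1}`, as an element: `p_r(𝐢)` if
`i_r ⇄ i_{r+1}`, `1` if `i_r → i_{r+1}` only, `p_r(𝐢)² + p_r(𝐢)` if `i_r ← i_{r+1}` only,
`1 + p_r(𝐢)` if unrelated. [folklore] -/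
def bkQs (r r' : Fin n) (χ : Fin n → k) : MonoidAlgebra k (Perm (Fin n)) :=
  if χ r' = χ r + 1 then (if χ r = χ r' + 1 then bkP k r r' χ else 1)
  else (if χ r = χ r' + 1 then bkP k r r' χ * bkP k r r' χ + bkP k r r' χ else 1 + bkP k r r' χ)

/-- **`φ_r ({}^{s_r}q_r(s_r𝐢)) w = q_r(s_r𝐢) φ_r w` on `M_𝐢`, `i_r ≠ i_{r+1}`.** [folklore] -/
theorem bkPhi_mul_bkQs_mul_of_mem {r r' : Fin n} (h : (r' : ℕ) = r + 1) {χ : Fin n → k}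
    (hc : χ r ≠ χ r') {w : MonoidAlgebra k (Perm (Fin n))} (hw : w ∈ jointEigenspace k χ) :
    bkPhi k r r' * (bkQs k r r' χ * w) = bkQ k r r' (χ ∘ swap r r') * (bkPhi k r r' * w) := by
  have e1 : (χ ∘ swap r r') r = χ r' := by simp [swap_apply_left]
  have e2 : (χ ∘ swap r r') r' = χ r := by simp [swap_apply_right]
  have m1 := bkPhi_mul_bkP_mul_of_mem k h hc hw
  have m2 := bkPhi_mul_bkP_mul_of_mem k h hc (bkP_mul_mem k r r' χ hw)
  rw [m1, mul_neg, neg_neg] at m2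
  unfold bkQs
  rw [bkQ, e1, e2, if_neg (Ne.symm hc)]
  by_cases h1 : χ r' = χ r + 1
  · by_cases h2 : χ r = χ r' + 1
    · simp only [if_pos h1, if_pos h2]
      rw [m1, neg_mul]
    · simp only [if_pos h1, if_neg h2]
      rw [one_mul, one_mul]
  · by_cases h2 : χ r = χ r' + 1
    · simp only [if_neg h1, if_pos h2]
      rw [add_mul, mul_add, mul_assoc (bkP k r r' χ), m2, m1, sub_mul, mul_assoc]
      abel
    · simp only [if_neg h1, if_neg h2]
      rw [add_mul, one_mul, mul_add, m1, sub_mul, one_mul]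
      abel

/-- `{}^{s_r}q_r(s_r𝐢)` is a unit. [folklore] -/
theorem isUnit_bkQs {r r' : Fin n} {χ : Fin n → k} (hc : χ r ≠ χ r') : IsUnit (bkQs k r r' χ) := by
  have hd : χ r - χ r' ≠ 0 := sub_ne_zero.2 hc
  have hp : bkP k r r' χ = Ring.inverse (bkDiffUnit k r r' (χ r - χ r')) := by rw [bkP, if_neg hc]
  have hP : IsUnit (bkP k r r' χ) := isUnit_bkP k r r' χ
  -- `1 + p = p (D + 1) = p · bkDiffUnit (c + 1)`, a unit iff `c + 1 ≠ 0`
  have h1p : ∀ (hc1 : χ r - χ r' + 1 ≠ 0), IsUnit (1 + bkP k r r' χ) := by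
    intro hc1
    have e : 1 + bkP k r r' χ = bkP k r r' χ * bkDiffUnit k r r' (χ r - χ r' + 1) := by
      rw [hp, show bkDiffUnit k r r' (χ r - χ r' + 1) = bkDiffUnit k r r' (χ r - χ r') + 1 by
        rw [bkDiffUnit, bkDiffUnit, map_add, map_one]; abel, mul_add, mul_one,
        Ring.inverse_mul_cancel _ (isUnit_bkDiffUnit k r r' hd)]
    rw [e]
    exact hP.mul (isUnit_bkDiffUnit k r r' hc1)
  unfold bkQs
  split_ifs with h1 h2 h3
  · exact hP
  · exact isUnit_one
  · have hc1 : χ r - χ r' + 1 ≠ 0 := by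
      intro e; apply h1; linear_combination -e
    rw [show bkP k r r' χ * bkP k r r' χ + bkP k r r' χ = bkP k r r' χ * (1 + bkP k r r' χ) by
      noncomm_ring]
    exact hP.mul (h1p hc1)
  · have hc1 : χ r - χ r' + 1 ≠ 0 := by
      intro e; apply h1; linear_combination -e
    exact h1p hc1

/-- The inverse form: `q_r(s_r𝐢)^{-1} φ_r w = φ_r ({}^{s_r}q_r(s_r𝐢))^{-1} w` on `M_𝐢`. [folklore] -/
theorem ringInverse_bkQ_swap_mul_bkPhi_mul_of_mem {r r' : Fin n} (h : (r' : ℕ) = r + 1)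
    {χ : Fin n → k} (hc : χ r ≠ χ r') {w : MonoidAlgebra k (Perm (Fin n))}
    (hw : w ∈ jointEigenspace k χ) :
    Ring.inverse (bkQ k r r' (χ ∘ swap r r')) * (bkPhi k r r' * w) =
      bkPhi k r r' * (Ring.inverse (bkQs k r r' χ) * w) := by
  have hu := isUnit_bkQs k (r := r) (r' := r') hc
  have hu' := isUnit_bkQ k r r' (χ ∘ swap r r')
  have hQsL : ∀ t, jucysMurphy k t * Ring.inverse (bkQs k r r' χ) =
      Ring.inverse (bkQs k r r' χ) * jucysMurphy k t := by
    intro t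
    have hpc : Commute (jucysMurphy k t) (bkP k r r' χ) :=
      commute_bkP k (commute_jucysMurphy_bkNilpotent k t) r r' χ
    have : Commute (jucysMurphy k t) (bkQs k r r' χ) := by
      unfold bkQs
      split_ifs
      · exact hpc
      · exact Commute.one_right _
      · exact (hpc.mul_right hpc).add_right hpc
      · exact (Commute.one_right _).add_right hpc
    exact (commute_ringInverse_of_commute this hu).eq
  have hw₁ : Ring.inverse (bkQs k r r' χ) * w ∈ jointEigenspace k χ :=
    mul_left_mem_jointEigenspace_of_comm k hQsL hw
  have key := bkPhi_mul_bkQs_mul_of_mem k h hc hw₁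
  rw [← mul_assoc (bkQs k r r' χ), Ring.mul_inverse_cancel _ hu, one_mul] at key
  rw [key, ← mul_assoc, Ring.inverse_mul_cancel _ hu', one_mul]

/-- **(R4), common part for `i_r ≠ i_{r+1}`:
`ψ_r² e(𝐢) = (1 - p_r(𝐢)²) ({}^{s_r}q_r(s_r𝐢))^{-1} q_r(𝐢)^{-1} e(𝐢)`** (Brundan–Kleshchev p. 9).
[folklore] -/
theorem bkPsi_mul_bkPsi_mul_klrIdempotent_of_ne {r r' : Fin n} (h : (r' : ℕ) = r + 1)
    {χ : Fin n → k} (hc : χ r ≠ χ r') :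
    bkPsi k r r' * bkPsi k r r' * klrIdempotent k χ =
      (1 - bkP k r r' χ * bkP k r r' χ) * Ring.inverse (bkQs k r r' χ) *
        Ring.inverse (bkQ k r r' χ) * klrIdempotent k χ := by
  have hQL : ∀ t, jucysMurphy k t * Ring.inverse (bkQ k r r' χ) =
      Ring.inverse (bkQ k r r' χ) * jucysMurphy k t :=
    fun t => (commute_ringInverse_bkQ k (commute_jucysMurphy_bkNilpotent k t) r r' χ).eq
  have hQe : Commute (klrIdempotent k χ) (Ring.inverse (bkQ k r r' χ)) :=
    commute_ringInverse_bkQ k (commute_klrIdempotent_bkNilpotent k χ) r r' χ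
  have hpc : ∀ z, (∀ t, Commute z (bkNilpotent k t)) → Commute z (bkP k r r' χ) :=
    fun z hz => commute_bkP k hz r r' χ
  have hQse : Commute (klrIdempotent k χ) (Ring.inverse (bkQs k r r' χ)) := by
    have hpe := hpc _ (commute_klrIdempotent_bkNilpotent k χ)
    have : Commute (klrIdempotent k χ) (bkQs k r r' χ) := by
      unfold bkQs
      split_ifs
      · exact hpe
      · exact Commute.one_right _
      · exact (hpe.mul_right hpe).add_right hpe
      · exact (Commute.one_right _).add_right hpe
    exact commute_ringInverse_of_commute this (isUnit_bkQs k hc)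
  have hw : Ring.inverse (bkQ k r r' χ) * klrIdempotent k χ ∈ jointEigenspace k χ :=
    mul_left_mem_jointEigenspace_of_comm k hQL (klrIdempotent_mem k χ)
  have h5 := bkPhi_mul_bkPhi_mul_klrIdempotent k h χ
  rw [if_neg hc] at h5
  have hp : bkP k r r' χ = Ring.inverse (bkDiffUnit k r r' (χ r - χ r')) := by rw [bkP, if_neg hc]
  rw [bkPsi_mul_bkPsi_mul_klrIdempotent k h, mul_assoc (bkPhi k r r') (Ring.inverse (bkQ k r r' χ)),
    mul_assoc (bkPhi k r r') (Ring.inverse (bkQ k r r' (χ ∘ swap r r'))),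
    ringInverse_bkQ_swap_mul_bkPhi_mul_of_mem k h hc hw, ← hQe.eq, ← mul_assoc (Ring.inverse (bkQs _ _ _ _)),
    ← hQse.eq, mul_assoc (klrIdempotent k χ), ← mul_assoc (bkPhi k r r'),
    ← mul_assoc (bkPhi k r r' * bkPhi k r r'), h5, hp, sq, mul_assoc _ (klrIdempotent k χ),
    ← mul_assoc (klrIdempotent k χ), hQse.eq, mul_assoc _ (klrIdempotent k χ), hQe.eq]
  noncomm_ring


/-- **(R4), `i_r, i_{r+1}` distinct and not adjacent: `ψ_r² e(𝐢) = e(𝐢)`** (Brundan–Kleshchev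
Thm 3.2). [folklore] -/
theorem bkPsi_sq_mul_klrIdempotent_of_unrelated {r r' : Fin n} (h : (r' : ℕ) = r + 1)
    {χ : Fin n → k} (hc : χ r ≠ χ r') (h1 : χ r' ≠ χ r + 1) (h2 : χ r ≠ χ r' + 1) :
    bkPsi k r r' * bkPsi k r r' * klrIdempotent k χ = klrIdempotent k χ := by
  have hq : bkQ k r r' χ = 1 - bkP k r r' χ := by rw [bkQ, if_neg hc, if_neg h1, if_neg h2]
  have hQs : bkQs k r r' χ = 1 + bkP k r r' χ := by rw [bkQs, if_neg h1, if_neg h2]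
  have hu1 : IsUnit (1 + bkP k r r' χ) := hQs ▸ isUnit_bkQs k hc
  have hu2 : IsUnit (1 - bkP k r r' χ) := hq ▸ isUnit_bkQ k r r' χ
  rw [bkPsi_mul_bkPsi_mul_klrIdempotent_of_ne k h hc, hq, hQs,
    show (1 - bkP k r r' χ * bkP k r r' χ) = (1 - bkP k r r' χ) * (1 + bkP k r r' χ) by noncomm_ring,
    mul_assoc (1 - bkP k r r' χ), Ring.mul_inverse_cancel _ hu1, mul_one,
    Ring.mul_inverse_cancel _ hu2, one_mul]

/-- `D P = 1`, `P D = 1` for `P = p_r(𝐢)`, `D = (i_r - i_{r+1}) + y_r - y_{r+1}`, `i_r ≠ i_{r+1}`.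
[folklore] -/
theorem bkP_mul_bkDiffUnit {r r' : Fin n} {χ : Fin n → k} (hc : χ r ≠ χ r') :
    bkP k r r' χ * bkDiffUnit k r r' (χ r - χ r') = 1 ∧
      bkDiffUnit k r r' (χ r - χ r') * bkP k r r' χ = 1 := by
  rw [bkP, if_neg hc]
  exact ⟨Ring.inverse_mul_cancel _ (isUnit_bkDiffUnit k r r' (sub_ne_zero.2 hc)),
    Ring.mul_inverse_cancel _ (isUnit_bkDiffUnit k r r' (sub_ne_zero.2 hc))⟩

/-- **(R4), `i_r → i_{r+1}` (`i_{r+1} = i_r + 1 ≠ i_r - 1`): `ψ_r² e(𝐢) = (y_{r+1} - y_r) e(𝐢)`**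
(Brundan–Kleshchev Thm 3.2). [folklore] -/
theorem bkPsi_sq_mul_klrIdempotent_of_fwd {r r' : Fin n} (h : (r' : ℕ) = r + 1)
    {χ : Fin n → k} (hc : χ r ≠ χ r') (h1 : χ r' = χ r + 1) (h2 : χ r ≠ χ r' + 1) :
    bkPsi k r r' * bkPsi k r r' * klrIdempotent k χ =
      (bkNilpotent k r' - bkNilpotent k r) * klrIdempotent k χ := by
  obtain ⟨hPD, hDP⟩ := bkP_mul_bkDiffUnit k (r := r) (r' := r') hc
  have hcv : χ r - χ r' = -1 := by rw [h1]; ring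
  have hq : bkQ k r r' χ = bkP k r r' χ * bkP k r r' χ - bkP k r r' χ := by
    rw [bkQ, if_neg hc, if_pos h1, if_neg h2]
  have hQs : bkQs k r r' χ = 1 := by rw [bkQs, if_pos h1, if_neg h2]
  -- `P² - P = (1 - D) P²`, `1 - P² = -((D + 1)(1 - D) P²)`
  have f1 : bkP k r r' χ * bkP k r r' χ - bkP k r r' χ =
      (1 - bkDiffUnit k r r' (χ r - χ r')) * (bkP k r r' χ * bkP k r r' χ) := by
    rw [sub_mul, one_mul, ← mul_assoc, hDP, one_mul]
  have f2 : 1 - bkP k r r' χ * bkP k r r' χ =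
      -((bkDiffUnit k r r' (χ r - χ r') + 1) *
        ((1 - bkDiffUnit k r r' (χ r - χ r')) * (bkP k r r' χ * bkP k r r' χ))) := by
    rw [show (bkDiffUnit k r r' (χ r - χ r') + 1) *
        ((1 - bkDiffUnit k r r' (χ r - χ r')) * (bkP k r r' χ * bkP k r r' χ)) =
        bkP k r r' χ * bkP k r r' χ -
          bkDiffUnit k r r' (χ r - χ r') * (bkDiffUnit k r r' (χ r - χ r') * bkP k r r' χ) * bkP k r r' χ
        by noncomm_ring, hDP, mul_one, hDP]
    abel
  have hu : IsUnit ((1 - bkDiffUnit k r r' (χ r - χ r')) * (bkP k r r' χ * bkP k r r' χ)) := by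
    rw [← f1, ← hq]; exact isUnit_bkQ k r r' χ
  rw [bkPsi_mul_bkPsi_mul_klrIdempotent_of_ne k h hc, hq, hQs, Ring.inverse_one, mul_one, f1, f2,
    neg_mul, mul_assoc (bkDiffUnit k r r' (χ r - χ r') + 1), Ring.mul_inverse_cancel _ hu, mul_one,
    hcv, bkDiffUnit, map_neg, map_one]
  congr 1
  abel

/-- **(R4), `i_r ← i_{r+1}` (`i_r = i_{r+1} + 1 ≠ i_{r+1} - 1`): `ψ_r² e(𝐢) = (y_r - y_{r+1}) e(𝐢)`**
(Brundan–Kleshchev Thm 3.2). [folklore] -/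
theorem bkPsi_sq_mul_klrIdempotent_of_bwd {r r' : Fin n} (h : (r' : ℕ) = r + 1)
    {χ : Fin n → k} (hc : χ r ≠ χ r') (h1 : χ r' ≠ χ r + 1) (h2 : χ r = χ r' + 1) :
    bkPsi k r r' * bkPsi k r r' * klrIdempotent k χ =
      (bkNilpotent k r - bkNilpotent k r') * klrIdempotent k χ := by
  obtain ⟨hPD, hDP⟩ := bkP_mul_bkDiffUnit k (r := r) (r' := r') hc
  have hcv : χ r - χ r' = 1 := by rw [h2]; ring
  have hq : bkQ k r r' χ = 1 := by rw [bkQ, if_neg hc, if_neg h1, if_pos h2]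
  have hQs : bkQs k r r' χ = bkP k r r' χ * bkP k r r' χ + bkP k r r' χ := by
    rw [bkQs, if_neg h1, if_pos h2]
  have f1 : bkP k r r' χ * bkP k r r' χ + bkP k r r' χ =
      (bkDiffUnit k r r' (χ r - χ r') + 1) * (bkP k r r' χ * bkP k r r' χ) := by
    rw [add_mul, one_mul, ← mul_assoc, hDP, one_mul, add_comm]
  have f2 : 1 - bkP k r r' χ * bkP k r r' χ =
      -((1 - bkDiffUnit k r r' (χ r - χ r')) *
        ((bkDiffUnit k r r' (χ r - χ r') + 1) * (bkP k r r' χ * bkP k r r' χ))) := by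
    rw [show (1 - bkDiffUnit k r r' (χ r - χ r')) *
        ((bkDiffUnit k r r' (χ r - χ r') + 1) * (bkP k r r' χ * bkP k r r' χ)) =
        bkP k r r' χ * bkP k r r' χ -
          bkDiffUnit k r r' (χ r - χ r') * (bkDiffUnit k r r' (χ r - χ r') * bkP k r r' χ) * bkP k r r' χ
        by noncomm_ring, hDP, mul_one, hDP]
    abel
  have hu : IsUnit ((bkDiffUnit k r r' (χ r - χ r') + 1) * (bkP k r r' χ * bkP k r r' χ)) := by
    rw [← f1, ← hQs]; exact isUnit_bkQs k hc
  rw [bkPsi_mul_bkPsi_mul_klrIdempotent_of_ne k h hc, hq, hQs, Ring.inverse_one, mul_one, f1, f2,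
    neg_mul, mul_assoc (1 - bkDiffUnit k r r' (χ r - χ r')), Ring.mul_inverse_cancel _ hu, mul_one,
    hcv, bkDiffUnit, map_one]
  congr 1
  abel

/-- **(R4), `i_r ⇄ i_{r+1}` (characteristic `2`): `ψ_r² e(𝐢) = (y_{r+1} - y_r)(y_r - y_{r+1}) e(𝐢)`**
(Brundan–Kleshchev Thm 3.2). [folklore] -/
theorem bkPsi_sq_mul_klrIdempotent_of_both {r r' : Fin n} (h : (r' : ℕ) = r + 1)
    {χ : Fin n → k} (hc : χ r ≠ χ r') (h1 : χ r' = χ r + 1) (h2 : χ r = χ r' + 1) :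
    bkPsi k r r' * bkPsi k r r' * klrIdempotent k χ =
      (bkNilpotent k r' - bkNilpotent k r) * (bkNilpotent k r - bkNilpotent k r') * klrIdempotent k χ := by
  obtain ⟨hPD, hDP⟩ := bkP_mul_bkDiffUnit k (r := r) (r' := r') hc
  have hcv : χ r - χ r' = 1 := by rw [h2]; ring
  have h11 : (1 : k) + 1 = 0 := by linear_combination -h1 - h2
  have h11A : (1 : MonoidAlgebra k (Perm (Fin n))) + 1 = 0 := by
    have e := congrArg (algebraMap k (MonoidAlgebra k (Perm (Fin n)))) h11
    rw [map_add, map_one, map_zero] at e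
    exact e
  have hq : bkQ k r r' χ = -bkP k r r' χ := by rw [bkQ, if_neg hc, if_pos h1, if_pos h2]
  have hQs : bkQs k r r' χ = bkP k r r' χ := by rw [bkQs, if_pos h1, if_pos h2]
  have hP : IsUnit (bkP k r r' χ) := isUnit_bkP k r r' χ
  have hinvP : Ring.inverse (bkP k r r' χ) = bkDiffUnit k r r' (χ r - χ r') := by
    calc Ring.inverse (bkP k r r' χ)
        = Ring.inverse (bkP k r r' χ) * (bkP k r r' χ * bkDiffUnit k r r' (χ r - χ r')) := by
          rw [hPD, mul_one]
      _ = _ := by rw [← mul_assoc, Ring.inverse_mul_cancel _ hP, one_mul]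
  -- `(1 - P²) D (-D) = 1 - D²`
  have f : (1 - bkP k r r' χ * bkP k r r' χ) * bkDiffUnit k r r' (χ r - χ r') *
      -bkDiffUnit k r r' (χ r - χ r') =
      1 - bkDiffUnit k r r' (χ r - χ r') * bkDiffUnit k r r' (χ r - χ r') := by
    rw [show (1 - bkP k r r' χ * bkP k r r' χ) * bkDiffUnit k r r' (χ r - χ r') *
        -bkDiffUnit k r r' (χ r - χ r') =
        -(bkDiffUnit k r r' (χ r - χ r') * bkDiffUnit k r r' (χ r - χ r')) +
          bkP k r r' χ * (bkP k r r' χ * bkDiffUnit k r r' (χ r - χ r')) * bkDiffUnit k r r' (χ r - χ r')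
        by noncomm_ring, hPD, mul_one, hPD]
    abel
  rw [bkPsi_mul_bkPsi_mul_klrIdempotent_of_ne k h hc, hq, hQs, ringInverse_neg hP, hinvP, f, hcv,
    bkDiffUnit, map_one]
  congr 1
  -- `1 - (1 + N)² = -N² - (N + N) = (-N) N` in characteristic `2`
  have hNN : (bkNilpotent k r - bkNilpotent k r') + (bkNilpotent k r - bkNilpotent k r') = 0 := by
    rw [← two_mul, show (2 : MonoidAlgebra k (Perm (Fin n))) = 1 + 1 by norm_num, h11A, zero_mul]
  calc 1 - (1 + (bkNilpotent k r - bkNilpotent k r')) * (1 + (bkNilpotent k r - bkNilpotent k r'))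
      = -((bkNilpotent k r - bkNilpotent k r') + (bkNilpotent k r - bkNilpotent k r')) -
          (bkNilpotent k r - bkNilpotent k r') * (bkNilpotent k r - bkNilpotent k r') := by noncomm_ring
    _ = _ := by rw [hNN]; noncomm_ring

/-- **(R4) of Brundan–Kleshchev's Theorem 3.2, all cases: `ψ_r² e(𝐢) = Q_{i_r i_{r+1}}(y_r, y_{r+1}) e(𝐢)`**
for the quiver `i → j ⟺ j = i + 1` — `0` if `i_r = i_{r+1}`, `1` if unrelated, `y_{r+1} - y_r` if
`i_r → i_{r+1}`, `y_r - y_{r+1}` if `i_r ← i_{r+1}`, `(y_{r+1} - y_r)(y_r - y_{r+1})` if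
`i_r ⇄ i_{r+1}` (arXiv:0808.2032, Main Theorem / Thm 3.2, relation (R4); cited through
[HuMathas2010, Thm 24]). [folklore] -/
theorem bkPsi_sq_mul_klrIdempotent {r r' : Fin n} (h : (r' : ℕ) = r + 1) (χ : Fin n → k) :
    bkPsi k r r' * bkPsi k r r' * klrIdempotent k χ =
      (if χ r = χ r' then 0
       else if χ r' = χ r + 1 then
         (if χ r = χ r' + 1 then (bkNilpotent k r' - bkNilpotent k r) * (bkNilpotent k r - bkNilpotent k r')
          else bkNilpotent k r' - bkNilpotent k r)
       else (if χ r = χ r' + 1 then bkNilpotent k r - bkNilpotent k r' else 1)) * klrIdempotent k χ := by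
  split_ifs with hc h1 h2 h2'
  · rw [zero_mul]; exact bkPsi_mul_bkPsi_mul_klrIdempotent_of_eq k h hc
  · exact bkPsi_sq_mul_klrIdempotent_of_both k h hc h1 h2
  · exact bkPsi_sq_mul_klrIdempotent_of_fwd k h hc h1 h2
  · exact bkPsi_sq_mul_klrIdempotent_of_bwd k h hc h1 h2'
  · rw [one_mul]; exact bkPsi_sq_mul_klrIdempotent_of_unrelated k h hc h1 h2'

end BKPsiSquare


/-! ### The cyclotomic relation at level one, and general exchange rules for `φ_r` -/

section BKCyclotomic

open Equiv

variable (k : Type*) [Field k] [DecidableEq k] {n : ℕ}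

omit [DecidableEq k] in
/-- `e(𝐢) = 0` unless `i_1 = 0` (`L_1 = 0` has the single eigenvalue `0`). [folklore] -/
theorem klrIdempotent_eq_zero_of_apply_ne_zero {r : Fin n} (hr : (r : ℕ) = 0) {χ : Fin n → k}
    (hχ : χ r ≠ 0) : klrIdempotent k χ = 0 := by
  refine klrIdempotent_eq_zero k ⟨r, fun c hc => ?_⟩
  have hc0 : c = 0 := by
    rw [Finset.mem_Icc, hr] at hc
    omega
  rw [hc0, Int.cast_zero]
  exact Ne.symm hχ

/-- **The cyclotomic relation of `R^{Λ₀}` (Brundan–Kleshchev Thm 3.2, relation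
`y_1^{(Λ₀, α_{i_1})} e(𝐢) = 0`): `y_1 e(𝐢) = 0`, and `e(𝐢) = 0` if `i_1 ≠ 0`.** [folklore] -/
theorem bkNilpotent_pow_mul_klrIdempotent_eq_zero {r : Fin n} (hr : (r : ℕ) = 0) (χ : Fin n → k) :
    bkNilpotent k r ^ (if χ r = 0 then 1 else 0) * klrIdempotent k χ = 0 := by
  split_ifs with h0
  · rw [pow_one, bkNilpotent_eq_zero k hr, zero_mul]
  · rw [pow_zero, one_mul, klrIdempotent_eq_zero_of_apply_ne_zero k hr h0]

/-- **`φ_r y_t w = y_{s_r t} φ_r w` on `M_𝐢` (`i_r ≠ i_{r+1}`), all `t`.** [folklore] -/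
theorem bkPhi_mul_bkNilpotent_mul_of_mem_gen {r r' : Fin n} (h : (r' : ℕ) = r + 1)
    {χ : Fin n → k} (hc : χ r ≠ χ r') {w : MonoidAlgebra k (Perm (Fin n))}
    (hw : w ∈ jointEigenspace k χ) (t : Fin n) :
    bkPhi k r r' * (bkNilpotent k t * w) = bkNilpotent k (swap r r' t) * (bkPhi k r r' * w) := by
  by_cases htr : t = r
  · subst htr; rw [swap_apply_left]; exact bkPhi_mul_bkNilpotent_mul_of_mem k h hc hw
  by_cases htr' : t = r'
  · subst htr'; rw [swap_apply_right]; exact bkPhi_mul_bkNilpotent_succ_mul_of_mem k h hc hw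
  rw [swap_apply_of_ne_of_ne htr htr', ← mul_assoc, bkPhi_mul_bkNilpotent_of_ne k h htr htr', mul_assoc]

/-- **`φ_r (c + y_a - y_b) w = (c + y_{s_ra} - y_{s_rb}) φ_r w` on `M_𝐢` (`i_r ≠ i_{r+1}`).**
[folklore] -/
theorem bkPhi_mul_bkDiffUnit_mul_of_mem_gen {r r' : Fin n} (h : (r' : ℕ) = r + 1)
    {χ : Fin n → k} (hc : χ r ≠ χ r') {w : MonoidAlgebra k (Perm (Fin n))}
    (hw : w ∈ jointEigenspace k χ) (a b : Fin n) (c : k) :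
    bkPhi k r r' * (bkDiffUnit k a b c * w) =
      bkDiffUnit k (swap r r' a) (swap r r' b) c * (bkPhi k r r' * w) := by
  rw [bkDiffUnit, bkDiffUnit, add_mul (algebraMap k _ c) (bkNilpotent k a - bkNilpotent k b) w,
    sub_mul (bkNilpotent k a) (bkNilpotent k b) w, mul_add (bkPhi k r r'), mul_sub (bkPhi k r r'),
    ← mul_assoc (bkPhi k r r') (algebraMap k _ c) w,
    ← (Algebra.commute_algebraMap_left c (bkPhi k r r')).eq, mul_assoc (algebraMap k _ c),
    bkPhi_mul_bkNilpotent_mul_of_mem_gen k h hc hw a, bkPhi_mul_bkNilpotent_mul_of_mem_gen k h hc hw b,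
    add_mul (algebraMap k _ c), sub_mul (bkNilpotent k (swap r r' a)) (bkNilpotent k (swap r r' b))]

/-- … and for the inverses (`c ≠ 0`). [folklore] -/
theorem bkPhi_mul_ringInverse_bkDiffUnit_mul_of_mem_gen {r r' : Fin n} (h : (r' : ℕ) = r + 1)
    {χ : Fin n → k} (hc : χ r ≠ χ r') {w : MonoidAlgebra k (Perm (Fin n))}
    (hw : w ∈ jointEigenspace k χ) (a b : Fin n) {c : k} (hc0 : c ≠ 0) :
    bkPhi k r r' * (Ring.inverse (bkDiffUnit k a b c) * w) =
      Ring.inverse (bkDiffUnit k (swap r r' a) (swap r r' b) c) * (bkPhi k r r' * w) := by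
  have hu := isUnit_bkDiffUnit k a b hc0
  have hu' := isUnit_bkDiffUnit k (swap r r' a) (swap r r' b) hc0
  have hw₁ : Ring.inverse (bkDiffUnit k a b c) * w ∈ jointEigenspace k χ :=
    mul_left_mem_jointEigenspace_of_comm k
      (fun t => (commute_ringInverse_of_commute (commute_jucysMurphy_bkDiffUnit k t a b c) hu).eq) hw
  have key := bkPhi_mul_bkDiffUnit_mul_of_mem_gen k h hc hw₁ a b c
  rw [← mul_assoc (bkDiffUnit k a b c), Ring.mul_inverse_cancel _ hu, one_mul] at key
  rw [key, ← mul_assoc (Ring.inverse (bkDiffUnit k _ _ c)) (bkDiffUnit k _ _ c),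
    Ring.inverse_mul_cancel _ hu', one_mul]

/-- **`φ_r p_{a}(𝐣) w = p_{s_ra}(𝐣 ∘ s_r) φ_r w` on `M_𝐢`** — the general exchange rule for the
`p`'s (positions `a, a'` arbitrary; the residues travel with the positions). [folklore] -/
theorem bkPhi_mul_bkP_mul_of_mem_gen {r r' : Fin n} (h : (r' : ℕ) = r + 1)
    {χ : Fin n → k} (hc : χ r ≠ χ r') {w : MonoidAlgebra k (Perm (Fin n))}
    (hw : w ∈ jointEigenspace k χ) (a a' : Fin n) (ψ : Fin n → k) :
    bkPhi k r r' * (bkP k a a' ψ * w) =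
      bkP k (swap r r' a) (swap r r' a') (ψ ∘ swap r r') * (bkPhi k r r' * w) := by
  unfold bkP
  simp only [Function.comp_apply, swap_apply_self]
  split_ifs with hψ
  · rw [one_mul, one_mul]
  · exact bkPhi_mul_ringInverse_bkDiffUnit_mul_of_mem_gen k h hc hw a a' (sub_ne_zero.2 hψ)

/-- `p_a(𝐣) w ∈ M_𝐢` for `w ∈ M_𝐢` (any positions and residues). [folklore] -/
theorem bkP_mul_mem_gen (a a' : Fin n) (ψ : Fin n → k) {χ : Fin n → k}
    {w : MonoidAlgebra k (Perm (Fin n))} (hw : w ∈ jointEigenspace k χ) :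
    bkP k a a' ψ * w ∈ jointEigenspace k χ :=
  mul_left_mem_jointEigenspace_of_comm k
    (fun t => (commute_bkP k (commute_jucysMurphy_bkNilpotent k t) a a' ψ).eq) hw

/-- **`φ_r q_{a}(𝐣) w = q_{s_ra}(𝐣 ∘ s_r) φ_r w` on `M_𝐢`** — the general exchange rule for the
`q`'s. [folklore] -/
theorem bkPhi_mul_bkQ_mul_of_mem_gen {r r' : Fin n} (h : (r' : ℕ) = r + 1)
    {χ : Fin n → k} (hc : χ r ≠ χ r') {w : MonoidAlgebra k (Perm (Fin n))}
    (hw : w ∈ jointEigenspace k χ) (a a' : Fin n) (ψ : Fin n → k) :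
    bkPhi k r r' * (bkQ k a a' ψ * w) =
      bkQ k (swap r r' a) (swap r r' a') (ψ ∘ swap r r') * (bkPhi k r r' * w) := by
  have m1 := bkPhi_mul_bkP_mul_of_mem_gen k h hc hw a a' ψ
  have m2 := bkPhi_mul_bkP_mul_of_mem_gen k h hc (bkP_mul_mem_gen k a a' ψ hw) a a' ψ
  rw [m1] at m2
  have my := bkPhi_mul_bkNilpotent_mul_of_mem_gen k h hc hw
  unfold bkQ
  simp only [Function.comp_apply, swap_apply_self]
  split_ifs
  · rw [add_mul, one_mul, sub_mul, mul_add, mul_sub, my a', my a, add_mul, one_mul, sub_mul]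
  · rw [neg_mul, mul_neg, m1, neg_mul]
  · rw [sub_mul, mul_sub, mul_assoc (bkP k a a' ψ), m2, m1, sub_mul, mul_assoc]
  · rw [one_mul, one_mul]
  · rw [sub_mul, one_mul, mul_sub, m1, sub_mul, one_mul]

/-- `q_a(𝐣) w ∈ M_𝐢` for `w ∈ M_𝐢`. [folklore] -/
theorem bkQ_mul_mem_gen (a a' : Fin n) (ψ : Fin n → k) {χ : Fin n → k}
    {w : MonoidAlgebra k (Perm (Fin n))} (hw : w ∈ jointEigenspace k χ) :
    bkQ k a a' ψ * w ∈ jointEigenspace k χ :=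
  mul_left_mem_jointEigenspace_of_comm k
    (fun t => (commute_bkQ k (commute_jucysMurphy_bkNilpotent k t) a a' ψ).eq) hw

/-- **`φ_r q_{a}(𝐣)^{-1} w = q_{s_ra}(𝐣 ∘ s_r)^{-1} φ_r w` on `M_𝐢`.** [folklore] -/
theorem bkPhi_mul_ringInverse_bkQ_mul_of_mem_gen {r r' : Fin n} (h : (r' : ℕ) = r + 1)
    {χ : Fin n → k} (hc : χ r ≠ χ r') {w : MonoidAlgebra k (Perm (Fin n))}
    (hw : w ∈ jointEigenspace k χ) (a a' : Fin n) (ψ : Fin n → k) :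
    bkPhi k r r' * (Ring.inverse (bkQ k a a' ψ) * w) =
      Ring.inverse (bkQ k (swap r r' a) (swap r r' a') (ψ ∘ swap r r')) * (bkPhi k r r' * w) := by
  have hu := isUnit_bkQ k a a' ψ
  have hu' := isUnit_bkQ k (swap r r' a) (swap r r' a') (ψ ∘ swap r r')
  have hw₁ : Ring.inverse (bkQ k a a' ψ) * w ∈ jointEigenspace k χ :=
    mul_left_mem_jointEigenspace_of_comm k
      (fun t => (commute_ringInverse_bkQ k (commute_jucysMurphy_bkNilpotent k t) a a' ψ).eq) hw
  have key := bkPhi_mul_bkQ_mul_of_mem_gen k h hc hw₁ a a' ψ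
  rw [← mul_assoc (bkQ k a a' ψ), Ring.mul_inverse_cancel _ hu, one_mul] at key
  rw [key, ← mul_assoc (Ring.inverse (bkQ k _ _ _)) (bkQ k _ _ _), Ring.inverse_mul_cancel _ hu',
    one_mul]

end BKCyclotomic


/-! ### The `ψ`-braid relation (R7), case `i_r, i_{r+1}, i_{r+2}` pairwise distinct -/

section BKPsiBraid

open Equiv

variable (k : Type*) [Field k] [DecidableEq k] {n : ℕ}

/-- `ψ_b w = φ_b q_b(𝐢)^{-1} w` for `w ∈ M_𝐢`. [folklore] -/
theorem bkPsi_mul_of_mem (b b' : Fin n) {χ : Fin n → k} {w : MonoidAlgebra k (Perm (Fin n))}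
    (hw : w ∈ jointEigenspace k χ) :
    bkPsi k b b' * w = bkPhi k b b' * (Ring.inverse (bkQ k b b' χ) * w) := by
  rw [← klrIdempotent_mul_of_mem k hw, ← mul_assoc, bkPsi_mul_klrIdempotent, mul_assoc, mul_assoc]

/-- `ψ_b φ_c w = φ_b φ_c q_{s_cb}(𝐢)^{-1} w` for `w ∈ M_𝐢` with `i_c ≠ i_{c+1}` (exchange through
`φ_c`). [folklore] -/
theorem bkPsi_mul_bkPhi_mul_of_mem (b b' : Fin n) {c c' : Fin n} (hcc : (c' : ℕ) = c + 1)
    {χ : Fin n → k} (hc : χ c ≠ χ c') {w : MonoidAlgebra k (Perm (Fin n))}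
    (hw : w ∈ jointEigenspace k χ) :
    bkPsi k b b' * (bkPhi k c c' * w) =
      bkPhi k b b' * (bkPhi k c c' * (Ring.inverse (bkQ k (swap c c' b) (swap c c' b') χ) * w)) := by
  have hex := bkPhi_mul_ringInverse_bkQ_mul_of_mem_gen k hcc hc hw (swap c c' b) (swap c c' b') χ
  rw [swap_apply_self, swap_apply_self] at hex
  rw [bkPsi_mul_of_mem k b b' (bkPhi_mul_mem k hcc hw), hex]

/-- **`ψ_a ψ_b ψ_c e(𝐢) = φ_a φ_b φ_c q_{s_cs_ba}(𝐢)^{-1} q_{s_cb}(𝐢)^{-1} q_c(𝐢)^{-1} e(𝐢)`**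
for `i_c ≠ i_{c+1}`, `(s_c𝐢)_b ≠ (s_c𝐢)_{b+1}` (Brundan–Kleshchev p. 9, Case 1, via the exchange
rules = (EDDR) without `∂`-terms). [folklore] -/
theorem bkPsi_triple_mul_klrIdempotent_eq {a a' b b' c c' : Fin n} (hbb : (b' : ℕ) = b + 1)
    (hcc : (c' : ℕ) = c + 1) {χ : Fin n → k} (hc : χ c ≠ χ c')
    (hb : (χ ∘ swap c c') b ≠ (χ ∘ swap c c') b') :
    bkPsi k a a' * bkPsi k b b' * bkPsi k c c' * klrIdempotent k χ =
      bkPhi k a a' * (bkPhi k b b' * (bkPhi k c c' *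
        (Ring.inverse (bkQ k (swap c c' (swap b b' a)) (swap c c' (swap b b' a')) χ) *
          (Ring.inverse (bkQ k (swap c c' b) (swap c c' b') χ) *
            (Ring.inverse (bkQ k c c' χ) * klrIdempotent k χ))))) := by
  have hL : ∀ (x x' : Fin n) (ψ : Fin n → k) {w}, w ∈ jointEigenspace k χ →
      Ring.inverse (bkQ k x x' ψ) * w ∈ jointEigenspace k χ := fun x x' ψ w hw =>
    mul_left_mem_jointEigenspace_of_comm k
      (fun t => (commute_ringInverse_bkQ k (commute_jucysMurphy_bkNilpotent k t) x x' ψ).eq) hw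
  have hw0 : Ring.inverse (bkQ k c c' χ) * klrIdempotent k χ ∈ jointEigenspace k χ :=
    hL c c' χ (klrIdempotent_mem k χ)
  have hW : Ring.inverse (bkQ k (swap c c' b) (swap c c' b') χ) *
      (Ring.inverse (bkQ k c c' χ) * klrIdempotent k χ) ∈ jointEigenspace k χ := hL _ _ _ hw0
  have hφW := bkPhi_mul_mem k hcc hW
  have hex := bkPhi_mul_ringInverse_bkQ_mul_of_mem_gen k hcc hc hW
    (swap c c' (swap b b' a)) (swap c c' (swap b b' a')) χ
  rw [swap_apply_self, swap_apply_self] at hex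
  rw [mul_assoc, mul_assoc, bkPsi_mul_of_mem k c c' (klrIdempotent_mem k χ),
    bkPsi_mul_bkPhi_mul_of_mem k b b' hcc hc hw0, bkPsi_mul_bkPhi_mul_of_mem k a a' hbb hb hφW, hex]

/-- (EI6), Case 1, on `M_𝐢`: `φ_rφ_{r+1}φ_r w = φ_{r+1}φ_rφ_{r+1} w` for `w ∈ M_𝐢`,
`i_r, i_{r+1}, i_{r+2}` distinct. [folklore] -/
theorem bkPhi_braid_mul_of_mem_of_ne {r r' r'' : Fin n} (h : (r' : ℕ) = r + 1)
    (h' : (r'' : ℕ) = r' + 1) {χ : Fin n → k} (hij : χ r ≠ χ r') (hjk : χ r' ≠ χ r'')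
    (hik : χ r ≠ χ r'') {w : MonoidAlgebra k (Perm (Fin n))} (hw : w ∈ jointEigenspace k χ) :
    bkPhi k r r' * (bkPhi k r' r'' * (bkPhi k r r' * w)) =
      bkPhi k r' r'' * (bkPhi k r r' * (bkPhi k r' r'' * w)) := by
  have he := bkPhi_braid_of_ne k h h' hij hjk hik
  rw [← klrIdempotent_mul_of_mem k hw, ← mul_assoc, ← mul_assoc, ← mul_assoc, he]
  simp only [mul_assoc]

/-- **(R7), Case 1: `ψ_rψ_{r+1}ψ_r e(𝐢) = ψ_{r+1}ψ_rψ_{r+1} e(𝐢)` for `i_r, i_{r+1}, i_{r+2}`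
pairwise distinct** (Brundan–Kleshchev Thm 3.2, (R7) "otherwise", Case 1 of the proof). [folklore] -/
theorem bkPsi_braid_of_ne {r r' r'' : Fin n} (h : (r' : ℕ) = r + 1) (h' : (r'' : ℕ) = r' + 1)
    {χ : Fin n → k} (hij : χ r ≠ χ r') (hjk : χ r' ≠ χ r'') (hik : χ r ≠ χ r'') :
    bkPsi k r r' * bkPsi k r' r'' * bkPsi k r r' * klrIdempotent k χ =
      bkPsi k r' r'' * bkPsi k r r' * bkPsi k r' r'' * klrIdempotent k χ := by
  have hrr' : r ≠ r' := by intro e; rw [Fin.ext_iff] at e; omega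
  have hr'r'' : r' ≠ r'' := by intro e; rw [Fin.ext_iff] at e; omega
  have hrr'' : r ≠ r'' := by intro e; rw [Fin.ext_iff] at e; omega
  have hb1 : (χ ∘ swap r r') r' ≠ (χ ∘ swap r r') r'' := by
    simp [swap_apply_right, swap_apply_of_ne_of_ne (Ne.symm hrr'') (Ne.symm hr'r'')]; exact hik
  have hb2 : (χ ∘ swap r' r'') r ≠ (χ ∘ swap r' r'') r' := by
    simp [swap_apply_left, swap_apply_of_ne_of_ne hrr' hrr'']; exact hik
  rw [bkPsi_triple_mul_klrIdempotent_eq k h' h hij hb1, bkPsi_triple_mul_klrIdempotent_eq k h h' hjk hb2]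
  simp only [swap_apply_left, swap_apply_right, swap_apply_of_ne_of_ne hrr' hrr'',
    swap_apply_of_ne_of_ne (Ne.symm hrr'') (Ne.symm hr'r'')]
  -- both sides: `(φφφ) q₂⁻¹ T⁻¹ q₁⁻¹ e` with the three inverses commuting
  have hL : ∀ (x x' : Fin n) {w}, w ∈ jointEigenspace k χ →
      Ring.inverse (bkQ k x x' χ) * w ∈ jointEigenspace k χ := fun x x' w hw =>
    mul_left_mem_jointEigenspace_of_comm k
      (fun t => (commute_ringInverse_bkQ k (commute_jucysMurphy_bkNilpotent k t) x x' χ).eq) hw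
  have cQ : ∀ x x' z z' : Fin n, Commute (Ring.inverse (bkQ k x x' χ)) (Ring.inverse (bkQ k z z' χ)) :=
    fun x x' z z' => (commute_bkQ k (fun t => (commute_bkQ k (commute_bkNilpotent k t) x x' χ).symm)
      z z' χ).ringInverse_ringInverse
  have hmem : Ring.inverse (bkQ k r' r'' χ) * (Ring.inverse (bkQ k r r'' χ) *
      (Ring.inverse (bkQ k r r' χ) * klrIdempotent k χ)) ∈ jointEigenspace k χ :=
    hL _ _ (hL _ _ (hL _ _ (klrIdempotent_mem k χ)))
  rw [bkPhi_braid_mul_of_mem_of_ne k h h' hij hjk hik hmem]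
  congr 3
  rw [← mul_assoc, ← mul_assoc, (cQ r' r'' r r'').eq,
    mul_assoc (Ring.inverse (bkQ k r r'' χ)) (Ring.inverse (bkQ k r' r'' χ)) (Ring.inverse (bkQ k r r' χ)),
    (cQ r' r'' r r').eq,
    ← mul_assoc (Ring.inverse (bkQ k r r'' χ)) (Ring.inverse (bkQ k r r' χ)) (Ring.inverse (bkQ k r' r'' χ)),
    (cQ r r'' r r').eq, mul_assoc, mul_assoc]

end BKPsiBraid

end Literature.RepresentationTheory.FiniteGroups
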